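import Literature.MathematicalPhysics.StatisticalMechanics.EdgeIsoperimetricFluctuations
import HarnessLib

/-!
# The edge-isoperimetric problem in `ℤ²` solved: `EIP²(n) = 2⌈2√n⌉`, i.e. `max #bonds = ⌊2n − 2√n⌋`
# (Harary–Harborth 1976; Mainini–Piovano–Stefanelli 2014), PROVED

Topic `Literature/MathematicalPhysics/StatisticalMechanics`, companion of
`EdgeIsoperimetricFluctuations.lean` (Mainini–Piovano–Schmidt–Stefanelli 2019 / Mainini–Schmidt 2020:
the `n^{3/4}` fluctuation law around the cubic Wulff shape in `ℤ³` / `ℤ^d`, vendored there as named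
facts).  That file lists among "WHAT IS NOT HERE" the two-dimensional characterisation
`b = ⌊2n − 2√n⌋` on which [MPSS19, Lemma 4.1] rests; this file PROVES it, in the same vocabulary
(`Site 2`, `boundaryPairs`, `IsEIPMinimizer`).  Cell `crystal3d-full` (D-0046), literature-typing
layer D-0088 (4), seat `littype-FC1-1` (gen 2).  Everything below is a theorem; no named facts.

## Sources, as printed

**[MPSS19]** E. Mainini, P. Piovano, B. Schmidt, U. Stefanelli, *`N^{3/4}` law in the cubic lattice*,
J. Stat. Phys. 176 (2019) 1480–1499 = arXiv:1807.00811 [MaininiPiovanoSchmidtStefanelli2019], §2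
(held, store key `paper:arxiv-1807.00811`, tex chunk p. 4): with
`Θ₂(E_d) := {(x, y) ∈ ℤ² × ℤ² : |x − y| = 1, x ∈ E_d, y ∈ ℤ² ∖ E_d}` and `η_d := min #Θ₂` over
`d`-point subsets of `ℤ²`,
"We recall from [MPS] that `E_d` solves (EIP²_d) if and only if the number of unit bonds of `E_d`
(i.e., `½ #{(x, y) ∈ E_d × E_d : |x − y| = 1}`) is equal to `⌊2d − 2√d⌋`.  This is equivalent to
`#Θ₂(E_d) = 4d − 2⌊2d − 2√d⌋`, i.e., to `#Θ₂(E_d) = 2⌈2√d⌉`.  We also recall from [MPS] that for any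
`d ∈ ℕ` there exists a minimizer `D_d` of EIP²_d of the type `D_d := R(s, s') ∪ L_e` for some
`s, s' ∈ ℕ` and `e ∈ ℕ ∪ {0}` such that `s' ∈ {s, s+1}`, `s·s' + e = d`, and `e < s'`, where
`R(s, s') := ℤ² ∩ ([1, s] × [1, s'])` and `L_e := ℤ² ∩ ((0, e] × {s'+1})` if `s' = s`,
`ℤ² ∩ ({s+1} × (0, e])` if `s' = s + 1`. … We refer to these 2-dimensional minimizers as daisies."

**[MPS14]** E. Mainini, P. Piovano, U. Stefanelli, *Finite crystallization in the square lattice*,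
Nonlinearity 27 (2014) 717–737 [MaininiPiovanoStefanelli2014] (held, store key
`paper:doi-10-1088-0951-7715-27-4-717`): §4, `β(n) := ⌊2n − 2√n⌋` (p. 8); **Proposition 4.3** (p. 9)
"For all `n` there exists a configuration `D_n` with `E = −β(n)`.  Proof. The proof consists in
constructing subsets of the square lattice with exactly `β(n)` bonds …"; **Theorem 5.1** (p. 10) "If
`C_n` is a ground state, then `C_n` is square, connected, and `E(C_n) = −β(n)`" (for their
two-plus-three-body energy every ground state is a subset of `ℤ²` and its energy is minus its number
of unit bonds); p. 2: "our results of Section 7 on isoperimetric inequalities on the square graph are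
closely related to some classical issue in Discrete Mathematics, see [4, 10]" with [10] = Harary–Harborth.

**[HH76]** F. Harary, H. Harborth, *Extremal animals*, J. Combin. Inform. System Sci. 1 (1976) 1–8
[HararyHarborth1976] — the original solution of the edge-isoperimetric problem on `ℤ²` (primary not
held; so attributed also by L. H. Harper, *Global Methods for Combinatorial Isoperimetric Problems*,
CUP 2004, §7.2: "A solution of the EIP on `ℤ²` was given by Harary and Harborth").  The tree already
PROVES the triangular-lattice half of [HH76] (`Literature/Geometry/DiscreteGeometry/
TriangularLatticeContactBound.lean`, `adjCount_le_two_mul_harborthNumber`); this is the square half.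

**[FK23]** M. Friedrich, L. Kreutz, *A proof of finite crystallization via stratification*,
J. Stat. Phys. 190 (2023) [FriedrichKreutz2023], Theorem 2.1 / §4.1: "the minimum of `F` is given by
`2⌈2√n⌉`, and … it is attained by subsets of `ℤ²`" (a different proof of the same value).

## The proof formalised here (ours; shorter than the printed inductions)

* LOWER BOUND `2⌈2√n⌉ ≤ #Θ₂(C)` (`two_mul_ceil_two_sqrt_le_card_boundaryPairs`): by the tree's
  `two_mul_sum_card_dropCoord_le_card_boundaryPairs` every lattice line meeting `C` carries two
  boundary pairs, so `#Θ₂(C) ≥ 2(a + b)` with `a`, `b` the numbers of occupied columns and rows; by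
  the tree's `card_le_card_dropCoord_mul_two`, `n ≤ a·b`; hence `(a+b)² ≥ 4ab ≥ 4n` and, `a + b`
  being an integer, `a + b ≥ ⌈2√n⌉`.  (No parity argument and no real isoperimetry needed.)
* UPPER BOUND: a daisy is *line-convex* (every lattice line meets it in an interval), and for
  line-convex sets each line carries EXACTLY two boundary pairs
  (`card_boundaryPairs_eq_two_mul_sum_card_dropCoord_of_isLineConvex`; the same counting device is
  proved for the venture tree in `Summits/Ventures/Crystal3D/StickySpheres/LineConvexBoundaryPairs.lean`,
  which a Literature file may not import — re-proved here), so `#Θ₂(daisy) = 2(#columns + #rows)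
  = 2(s + s' + [e ≠ 0]) = 2⌈2√(ss' + e)⌉` by a four-case check, and every `n ≥ 1` is `ss' + e` with
  `s = ⌊√n⌋`.
* Hence `EIP²(n) = 2⌈2√n⌉`: `C ⊂ ℤ²` is an `EIP²` minimizer iff `#Θ₂(C) = 2⌈2√#C⌉` iff its number of
  ordered bonds is `2⌊2#C − 2√#C⌋` (`#Θ₂ + 2b = 4·#C`, `card_boundaryPairs_add_card_adjPairs`), and
  every `C` has at most `⌊2n − 2√n⌋` bonds.

## Contents (namespace `Literature.MathematicalPhysics.StatisticalMechanics`; all PROVED)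

`ceil_two_sqrt_le_add`, `two_mul_ceil_two_sqrt_le_card_boundaryPairs` (lower bound, every finite
`C ⊂ ℤ²`); `IsLineConvex` (definition) with `IsLineConvex.card_filter_boundaryPairs_eq_card_dropCoord`,
`card_boundaryPairs_eq_two_mul_sum_card_dropCoord_of_isLineConvex` (any dimension); the daisies
`latticeRect`, `daisyLine`, `daisy` with `mem_*`, `card_daisy`, `isLineConvex_daisy`,
`card_boundaryPairs_daisy`; the arithmetic `ceil_two_sqrt_daisy`, `exists_daisy_params` (plus
private plumbing: coordinates of lines in `ℤ²`, `⌈2√N⌉ = k+1` from `k² < 4N ≤ (k+1)²`); the results `exists_daisy_isEIPMinimizer` ([MPSS19] §2 / [MPS14] Prop. 4.3),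
`isEIPMinimizer_iff_card_boundaryPairs_eq` (`EIP²(n) = 2⌈2√n⌉`), `natFloor_two_mul_sub_two_sqrt`
(`⌊2n − 2√n⌋ = 2n − ⌈2√n⌉`), `card_adjPairs_le_two_mul_natFloor` (`b(C) ≤ ⌊2n − 2√n⌋` for every `C`),
`isEIPMinimizer_iff_card_adjPairs_eq` (the printed bond characterisation);
`card_dropCoord_lt_card_filter_boundaryPairs_of_not_isLineConvex` (a non-convex line carries an extra
boundary pair, any dimension) and `IsEIPMinimizer.isLineConvex` ([MPS14] Prop. 6.3: minimizers are
convex by rows and columns = the `d = 2` content of [MS20] Cor. 3.3); and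
`MaininiSchmidt2020_lemma35_two` — the `d = 2` instance of the named fact `MaininiSchmidt2020_lemma35`
(slab-deficient squares `{1,…,ℓ−p} × {1,…,ℓ}`, `p ≤ ⌊√ℓ⌋`, are `EIP²` minimizers), PROVED; and
(section `Fluctuation`) `MaininiSchmidt2020_thm11_lower_two` — the `d = 2` instance of the named
fact `MaininiSchmidt2020_thm11_lower` ([MS20] Theorem 1.1 (ii), the SHARPNESS of the planar
`n^{3/4}` law), PROVED with `K₂ = ½`: the slabs `planarSlab k = {1,…,4t²−2t} × {1,…,4t²}`
(`t = k+1`; minimizers by `MaininiSchmidt2020_lemma35_two`) miss, for every translate of the Wulff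
square `W_n = {1,…,⌊√n⌋}²` (`⌊√n⌋ = 4t² − t − 1`, `latticeRootFloor_card_planarSlab`), at least
`t + 1` full rows, i.e. `≥ ½·n^{3/4}` points (`le_card_planarSlab_sdiff_of`,
`half_mul_rpow_card_planarSlab_le`); and `MaininiSchmidt2020_thm11_upper_two` — the `d = 2` instance
of the named fact `MaininiSchmidt2020_thm11_upper` ([MS20] Theorem 1.1 (i): the planar `n^{3/4}` LAW
itself, [MPS14] §8 / [FK23] Thm 2.2 on the lattice), PROVED with `K₂ = 16`: a minimizer is convex by
rows and columns and meets every lattice line inside its shadow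
(`IsEIPMinimizer.exists_apply_eq_of_lt_of_lt`, by the strict superadditivity
`ceil_two_sqrt_add_one_le` of `⌈2√·⌉`), hence sits in an `a × b` box with `a + b = ⌈2√n⌉`
(`IsEIPMinimizer.exists_shift`, `IsEIPMinimizer.card_image_add_card_image_rev`), and such a box is
`2⌊√n⌋·|a − b| + O(√n) ≤ 16 n^{3/4}` points away from the corner-aligned Wulff square; and
(section `MPSSLemma`) `MaininiPiovanoSchmidtStefanelli2019_lemma41` — [MPSS19] Lemma 4.1 PROVED
(for `p ≤ s − 2`; the printed range `p < s` over-claims at `p = s − 1`, see the docstring):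
`𝓡_{s,p,q} = R(s−p−1, s) ∪ ({s−p} × [1, s−q])` (`mpssRect`) is an `EIP²` minimizer iff
`4(s − q) > (p+1)²`, with the "in particular" `isEIPMinimizer_mpssRect_sqrt` (`p = ⌊√s⌋`,
`q = ⌊s/4⌋`, `s ≥ 3`).

WHAT IS NOT HERE: the off-lattice crystallization theorems themselves ([MPS14] Thm 5.1, [FK23]
Thm 2.1: ground states of the two-plus-three-body energies ARE subsets of `ℤ²`) — only their
on-lattice combinatorial core; squareness / uniqueness of minimizers ([MPS14] Thm 6.1, §7
quasirectangles) beyond the box statement above.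
-/

noncomputable section

open Finset

namespace Literature.MathematicalPhysics.StatisticalMechanics

open Literature.Probability.LatticeModels

/-! ### The lower bound `2⌈2√n⌉ ≤ #Θ₂(C)` -/

/-- If `n ≤ a·b` for natural numbers then `⌈2√n⌉ ≤ a + b` (from `(a + b)² ≥ 4ab ≥ 4n` and the
integrality of `a + b`) — the arithmetic step "`2(l(s₀) + lᵛ) ≥ 2(l(s₀) + n/l(s₀)) ≥ 4√n > 2⌈2√n⌉ − 2`,
… since `2#𝒮 ∈ 2ℕ`" of the stratification proof.
[cite: FriedrichKreutz2023, §4.1 (proof of Theorem 2.1, case (a))] -/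
theorem ceil_two_sqrt_le_add {n a b : ℕ} (h : n ≤ a * b) :
    ⌈2 * Real.sqrt (n : ℝ)⌉₊ ≤ a + b := by
  refine Nat.ceil_le.mpr ?_
  have hab : (4 : ℝ) * n ≤ ((a + b : ℕ) : ℝ) ^ 2 := by
    have h1 : (n : ℝ) ≤ ((a * b : ℕ) : ℝ) := by exact_mod_cast h
    push_cast at h1 ⊢
    nlinarith [sq_nonneg ((a : ℝ) - b)]
  have h0 : (0 : ℝ) ≤ ((a + b : ℕ) : ℝ) := by positivity
  have h4 : Real.sqrt 4 = 2 := by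
    rw [show (4 : ℝ) = 2 ^ 2 by norm_num, Real.sqrt_sq (by norm_num : (0 : ℝ) ≤ 2)]
  calc 2 * Real.sqrt (n : ℝ) = Real.sqrt (4 * n) := by
        rw [Real.sqrt_mul (by norm_num : (0 : ℝ) ≤ 4), h4]
    _ ≤ Real.sqrt (((a + b : ℕ) : ℝ) ^ 2) := Real.sqrt_le_sqrt hab
    _ = ((a + b : ℕ) : ℝ) := Real.sqrt_sq h0

/-- **Harary–Harborth lower bound (the edge-isoperimetric inequality of `ℤ²` in its sharp integer
form).**  Every finite `C ⊂ ℤ²` has edge perimeter `#Θ₂(C) ≥ 2⌈2√#C⌉`: with `a`, `b` the numbers of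
lattice columns and rows meeting `C`, each such line carries two boundary pairs (`#Θ₂(C) ≥ 2(a+b)`)
and `#C ≤ ab`, so `a + b ≥ ⌈2√#C⌉` — the argument of Friedrich–Kreutz's case (a)
("`F_bond(G_o) = 2#𝒮 ≥ 2(l(s₀) + lᵛ) ≥ 2(l(s₀) + n/l(s₀)) ≥ 4√n`"), here for lattice sets.
[cite: MaininiPiovanoSchmidtStefanelli2019, §2 (η_d = #Θ₂ of minimizers = 2⌈2√d⌉, recalled from [MPS14]); HararyHarborth1976; FriedrichKreutz2023, Theorem 2.1 with §4.1 case (a)] -/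
theorem two_mul_ceil_two_sqrt_le_card_boundaryPairs (C : Finset (Site 2)) :
    2 * ⌈2 * Real.sqrt (#C : ℝ)⌉₊ ≤ #(boundaryPairs C) := by
  have h1 : #C ≤ #(dropCoord 0 C) * #(dropCoord 1 C) := card_le_card_dropCoord_mul_two C
  have h2 : 2 * ∑ i : Fin 2, #(dropCoord i C) ≤ #(boundaryPairs C) :=
    two_mul_sum_card_dropCoord_le_card_boundaryPairs C
  simp only [Fin.sum_univ_two] at h2
  have h3 := ceil_two_sqrt_le_add h1
  omega

/-! ### Line-convex sets: each lattice line carries exactly two boundary pairs -/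

section LineConvex

variable {n : ℕ}

/-- `A ⊆ ℤ^{n+1}` is **line-convex in direction `i`**: every lattice line of direction `eᵢ` meets `A`
in an interval (`x, y ∈ A` on one such line and `z` between them on that line ⇒ `z ∈ A`).  For
`ℤ²` and both directions this is Mainini–Piovano–Stefanelli's "convex by rows and columns" ("for
every `z ∈ ℤ` both the bond graph of the row `C_n(·, z)` and the bond graph of the column `C_n(z, ·)`
of `C_n` are connected"); we state the one-direction notion in any dimension.  E.g. the lattice
points of a convex body, rectangles, daisies.
[cite: MaininiPiovanoStefanelli2014, §2 eq. (5) (rows, columns; "convex by rows and columns")] -/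
def IsLineConvex (i : Fin (n + 1)) (A : Finset (Site (n + 1))) : Prop :=
  ∀ x ∈ A, ∀ y ∈ A, Fin.removeNth i x = Fin.removeNth i y →
    ∀ z : Site (n + 1), Fin.removeNth i z = Fin.removeNth i x → x i ≤ z i → z i ≤ y i → z ∈ A

/-- Two points of `ℤ^{n+1}` with the same projection forgetting `i` and the same `i`-th coordinate
are equal. [folklore] -/
private theorem site_eq_of_removeNth_eq_of_apply_eq {i : Fin (n + 1)} {x y : Site (n + 1)}
    (h : Fin.removeNth i x = Fin.removeNth i y) (hi : x i = y i) : x = y := by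
  rw [← Fin.insertNth_self_removeNth i x, ← Fin.insertNth_self_removeNth i y, h, hi]

/-- Moving along `± eᵢ` does not change the projection forgetting `i`. [folklore] -/
private theorem removeNth_add_unitStep_eq (i : Fin (n + 1)) (b : Bool) (x : Site (n + 1)) :
    Fin.removeNth i (x + unitStep i b) = Fin.removeNth i x := by
  funext l
  simp only [Fin.removeNth, Pi.add_apply, unitStep_apply, if_neg (Fin.succAbove_ne i l), add_zero]

/-- **One boundary pair per line and sense.**  For a set line-convex in direction `i`, the boundary
pairs of direction `(i, b)` are in bijection with the lattice lines of direction `eᵢ` meeting the set: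
`#{t ∈ boundaryPairs A | t.2 = (i, b)} = |πᵢ A|` (equality in the tree's
`card_dropCoord_le_card_filter_boundaryPairs`).  This is the line-convex case of Friedrich–Kreutz's
stratum count "`F_bond(G) = Σ_x (4 − #𝒩(x)) = 2#𝒮`" (two missing bonds per stratum = maximal
lattice segment; for a line-convex set the strata of direction `eᵢ` are the lines meeting it).  Twin
of the venture-side `Summit.Ventures.Crystal3D.card_filter_boundaryPairs_eq_card_dropCoord`,
re-proved because Literature does not import Summits.
[cite: FriedrichKreutz2023, Lemma 3.3 (ii) (F_bond(G) = 2·#𝒮)] -/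
theorem IsLineConvex.card_filter_boundaryPairs_eq_card_dropCoord {i : Fin (n + 1)}
    {A : Finset (Site (n + 1))} (hA : IsLineConvex i A) (b : Bool) :
    #{t ∈ boundaryPairs A | t.2 = (i, b)} = #(dropCoord i A) := by
  classical
  refine le_antisymm ?_ (card_dropCoord_le_card_filter_boundaryPairs i b A)
  refine card_le_card_of_injOn (fun t => Fin.removeNth i t.1) (fun t ht => ?_) ?_
  · have ht' := (mem_filter.1 (mem_coe.1 ht)).1
    rw [mem_boundaryPairs] at ht'
    exact mem_coe.2 (mem_dropCoord_iff.2 ⟨t.1, ht'.1, rfl⟩)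
  · intro t ht t' ht' heq
    obtain ⟨htb, ht2⟩ := mem_filter.1 (mem_coe.1 ht)
    obtain ⟨htb', ht2'⟩ := mem_filter.1 (mem_coe.1 ht')
    rw [mem_boundaryPairs] at htb htb'
    have hdir : t.2 = t'.2 := ht2.trans ht2'.symm
    suffices hx : t.1 = t'.1 from Prod.ext hx hdir
    -- two base points on one line: the one "behind" would have its successor in `A`
    have key : ∀ (u v : Site (n + 1)), u ∈ A → v ∈ A → u + unitStep i b ∉ A →
        Fin.removeNth i u = Fin.removeNth i v → (if b then u i < v i else v i < u i) → False := by
      intro u v hu hv hout huv hlt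
      apply hout
      cases b with
      | true =>
        simp only [if_true] at hlt
        refine hA u hu v hv huv (u + unitStep i true) (removeNth_add_unitStep_eq i true u) ?_ ?_
        · simp [unitStep_apply]
        · have : (u + unitStep i true) i = u i + 1 := by simp [unitStep_apply]
          rw [this]; omega
      | false =>
        simp only [Bool.false_eq_true, if_false] at hlt
        refine hA v hv u hu huv.symm (u + unitStep i false) ?_ ?_ ?_
        · rw [removeNth_add_unitStep_eq, huv]
        · have : (u + unitStep i false) i = u i - 1 := by simp [unitStep_apply]; ring
          rw [this]; omega
        · have : (u + unitStep i false) i = u i - 1 := by simp [unitStep_apply]; ring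
          rw [this]; omega
    have ht2i : t.2 = (i, b) := ht2
    have ht2i' : t'.2 = (i, b) := ht2'
    have hout : t.1 + unitStep i b ∉ A := by
      have := htb.2; rw [ht2i] at this; exact this
    have hout' : t'.1 + unitStep i b ∉ A := by
      have := htb'.2; rw [ht2i'] at this; exact this
    rcases lt_trichotomy (t.1 i) (t'.1 i) with hlt | heqi | hgt
    · exfalso
      cases b with
      | true => exact key t.1 t'.1 htb.1 htb'.1 hout heq (by simpa using hlt)
      | false => exact key t'.1 t.1 htb'.1 htb.1 hout' heq.symm (by simpa using hlt)
    · exact site_eq_of_removeNth_eq_of_apply_eq heq heqi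
    · exfalso
      cases b with
      | true => exact key t'.1 t.1 htb'.1 htb.1 hout' heq.symm (by simpa using hgt)
      | false => exact key t.1 t'.1 htb.1 htb'.1 hout heq (by simpa using hgt)

/-- **`#∂A = 2 Σᵢ |πᵢ A|` for sets line-convex in every direction**: equality in the tree's
`two_mul_sum_card_dropCoord_le_card_boundaryPairs` — in `ℤ²`: a configuration convex by rows and
columns has edge perimeter twice its number of rows plus columns (Friedrich–Kreutz: `F_bond = 2#𝒮`
with the strata being the rows and columns).  (Venture-side twin:
`Summit.Ventures.Crystal3D.card_boundaryPairs_eq_two_mul_sum_card_dropCoord`.)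
[cite: FriedrichKreutz2023, Lemma 3.3 (ii) (F_bond(G) = 2·#𝒮) with §4.1; MaininiPiovanoStefanelli2014, §2 eq. (5)] -/
theorem card_boundaryPairs_eq_two_mul_sum_card_dropCoord_of_isLineConvex (A : Finset (Site (n + 1)))
    (hA : ∀ i : Fin (n + 1), IsLineConvex i A) :
    #(boundaryPairs A) = 2 * ∑ i : Fin (n + 1), #(dropCoord i A) := by
  classical
  have hdecomp : #(boundaryPairs A) =
      ∑ c : Fin (n + 1) × Bool, #{t ∈ boundaryPairs A | t.2 = c} :=
    card_eq_sum_card_fiberwise fun t _ => mem_coe.2 (mem_univ t.2)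
  rw [hdecomp, Fintype.sum_prod_type, mul_sum]
  refine sum_congr rfl fun i _ => ?_
  rw [Fintype.sum_bool, (hA i).card_filter_boundaryPairs_eq_card_dropCoord true,
    (hA i).card_filter_boundaryPairs_eq_card_dropCoord false, two_mul]

end LineConvex

/-! ### Planar bookkeeping: lines of `ℤ²` are levels of one coordinate -/

/-- In `ℤ²` two points lie on one line of direction `e₀` iff their coordinates `1` agree. [folklore] -/
private theorem removeNth_zero_eq_iff {x y : Site 2} :
    Fin.removeNth 0 x = Fin.removeNth 0 y ↔ x 1 = y 1 := by
  constructor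
  · intro h
    have := congrFun h 0
    simpa [Fin.removeNth] using this
  · intro h
    funext j
    have hj : j = 0 := Subsingleton.elim j 0
    subst hj
    simpa [Fin.removeNth] using h

/-- In `ℤ²` two points lie on one line of direction `e₁` iff their coordinates `0` agree. [folklore] -/
private theorem removeNth_one_eq_iff {x y : Site 2} :
    Fin.removeNth 1 x = Fin.removeNth 1 y ↔ x 0 = y 0 := by
  constructor
  · intro h
    have := congrFun h 0
    simpa [Fin.removeNth] using this
  · intro h
    funext j
    have hj : j = 0 := Subsingleton.elim j 0
    subst hj
    simpa [Fin.removeNth] using h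

/-- The lines of direction `e₀` meeting `A ⊂ ℤ²` are counted by the occupied values of coordinate `1`
(the occupied rows `C_n(·, z) ≠ ∅`). [cite: MaininiPiovanoStefanelli2014, §2 eq. (5) (rows C_n(·, z))] -/
theorem card_dropCoord_zero_eq (A : Finset (Site 2)) :
    #(dropCoord 0 A) = #(A.image fun x => x 1) := by
  classical
  have hinj : Function.Injective (fun w : Site 1 => w 0) := by
    intro w w' h
    funext j
    have hj : j = 0 := Subsingleton.elim j 0
    subst hj
    exact h
  have hfun : ((fun w : Site 1 => w 0) ∘ Fin.removeNth (0 : Fin 2)) = fun x : Site 2 => x 1 := by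
    funext x
    simp [Fin.removeNth]
  rw [dropCoord, ← card_image_of_injective (A.image (Fin.removeNth 0)) hinj, image_image, hfun]

/-- The lines of direction `e₁` meeting `A ⊂ ℤ²` are counted by the occupied values of coordinate `0`
(the occupied columns `C_n(z, ·) ≠ ∅`). [cite: MaininiPiovanoStefanelli2014, §2 eq. (5) (columns C_n(z, ·))] -/
theorem card_dropCoord_one_eq (A : Finset (Site 2)) :
    #(dropCoord 1 A) = #(A.image fun x => x 0) := by
  classical
  have hinj : Function.Injective (fun w : Site 1 => w 0) := by
    intro w w' h
    funext j
    have hj : j = 0 := Subsingleton.elim j 0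
    subst hj
    exact h
  have hfun : ((fun w : Site 1 => w 0) ∘ Fin.removeNth (1 : Fin 2)) = fun x : Site 2 => x 0 := by
    funext x
    simp [Fin.removeNth]
  rw [dropCoord, ← card_image_of_injective (A.image (Fin.removeNth 1)) hinj, image_image, hfun]

/-! ### Daisies -/

/-- The lattice rectangle `R(s, s') = ℤ² ∩ ([1, s] × [1, s'])` (`s` columns, `s'` rows).
[cite: MaininiPiovanoSchmidtStefanelli2019, §2 (R(s,s'))] -/
def latticeRect (s s' : ℕ) : Finset (Site 2) :=
  Fintype.piFinset fun i : Fin 2 => if (i : ℕ) = 0 then Icc (1 : ℤ) s else Icc (1 : ℤ) s'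

/-- The extra line `L_e` of a daisy: `ℤ² ∩ ((0, e] × {s'+1})` (a partial row on top) if `s' = s`,
and `ℤ² ∩ ({s+1} × (0, e])` (a partial column on the right) otherwise (the source's case
`s' = s + 1`). [cite: MaininiPiovanoSchmidtStefanelli2019, §2 (L_e)] -/
def daisyLine (s s' e : ℕ) : Finset (Site 2) :=
  if s' = s then Fintype.piFinset fun i : Fin 2 => if (i : ℕ) = 0 then Icc (1 : ℤ) e else {(s' : ℤ) + 1}
  else Fintype.piFinset fun i : Fin 2 => if (i : ℕ) = 0 then {(s : ℤ) + 1} else Icc (1 : ℤ) e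

/-- The **daisy** `D = R(s, s') ∪ L_e` of Mainini–Piovano–Stefanelli: an `s × s'` lattice rectangle,
`s' ∈ {s, s+1}`, with `e < s'` further points in a row on top (`s' = s`) or a column on the right
(`s' = s + 1`); `#D = ss' + e`.  (Defined for all `s, s', e`; the daisy hypotheses enter the lemmas.)
[cite: MaininiPiovanoSchmidtStefanelli2019, §2 (daisies D_d = R(s,s') ∪ L_e)] -/
def daisy (s s' e : ℕ) : Finset (Site 2) := latticeRect s s' ∪ daisyLine s s' e

/-- Membership in the rectangle. [cite: MaininiPiovanoSchmidtStefanelli2019, §2 (R(s,s'))] -/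
theorem mem_latticeRect {s s' : ℕ} {z : Site 2} :
    z ∈ latticeRect s s' ↔ 1 ≤ z 0 ∧ z 0 ≤ s ∧ 1 ≤ z 1 ∧ z 1 ≤ s' := by
  simp [latticeRect, Fintype.mem_piFinset, Fin.forall_fin_two, and_assoc]

/-- Membership in the extra line. [cite: MaininiPiovanoSchmidtStefanelli2019, §2 (L_e)] -/
theorem mem_daisyLine {s s' e : ℕ} {z : Site 2} :
    z ∈ daisyLine s s' e ↔
      (s' = s ∧ 1 ≤ z 0 ∧ z 0 ≤ e ∧ z 1 = s' + 1) ∨ (s' ≠ s ∧ z 0 = s + 1 ∧ 1 ≤ z 1 ∧ z 1 ≤ e) := by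
  unfold daisyLine
  split_ifs with h
  · simp [Fintype.mem_piFinset, Fin.forall_fin_two, h, and_assoc]
  · simp [Fintype.mem_piFinset, Fin.forall_fin_two, h]

/-- Membership in a daisy, in coordinates. [cite: MaininiPiovanoSchmidtStefanelli2019, §2 (daisies)] -/
theorem mem_daisy {s s' e : ℕ} {z : Site 2} :
    z ∈ daisy s s' e ↔
      (1 ≤ z 0 ∧ z 0 ≤ s ∧ 1 ≤ z 1 ∧ z 1 ≤ s') ∨
        (s' = s ∧ 1 ≤ z 0 ∧ z 0 ≤ e ∧ z 1 = s' + 1) ∨ (s' ≠ s ∧ z 0 = s + 1 ∧ 1 ≤ z 1 ∧ z 1 ≤ e) := by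
  rw [daisy, mem_union, mem_latticeRect, mem_daisyLine]

/-- `#R(s, s') = s·s'`. [cite: MaininiPiovanoSchmidtStefanelli2019, §2 (R(s,s'))] -/
theorem card_latticeRect (s s' : ℕ) : #(latticeRect s s') = s * s' := by
  simp [latticeRect, Fintype.card_piFinset, Fin.prod_univ_two, Int.card_Icc]

/-- `#L_e = e`. [cite: MaininiPiovanoSchmidtStefanelli2019, §2 (L_e)] -/
theorem card_daisyLine (s s' e : ℕ) : #(daisyLine s s' e) = e := by
  unfold daisyLine
  split_ifs with h
  · simp [Fintype.card_piFinset, Fin.prod_univ_two, Int.card_Icc]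
  · simp [Fintype.card_piFinset, Fin.prod_univ_two, Int.card_Icc]

/-- The rectangle and the extra line of a daisy are disjoint (the line sits in row `s'+1`, resp.
column `s+1`). [cite: MaininiPiovanoSchmidtStefanelli2019, §2 (daisies)] -/
theorem disjoint_latticeRect_daisyLine (s s' e : ℕ) : Disjoint (latticeRect s s') (daisyLine s s' e) := by
  rw [Finset.disjoint_left]
  intro z hz hz'
  rw [mem_latticeRect] at hz
  rw [mem_daisyLine] at hz'
  omega

/-- **`#D = s·s' + e`** for the daisy `D = R(s, s') ∪ L_e`.
[cite: MaininiPiovanoSchmidtStefanelli2019, §2 (s·s' + e = d)] -/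
theorem card_daisy (s s' e : ℕ) : #(daisy s s' e) = s * s' + e := by
  rw [daisy, card_union_of_disjoint (disjoint_latticeRect_daisyLine s s' e), card_latticeRect,
    card_daisyLine]

/-- Daisies are line-convex in both lattice directions (their rows and columns are intervals).
[cite: MaininiPiovanoSchmidtStefanelli2019, §2 (daisies)] -/
theorem isLineConvex_daisy (s s' e : ℕ) (i : Fin 2) : IsLineConvex i (daisy s s' e) := by
  intro x hx y hy hxy z hzx hxz hzy
  rw [mem_daisy] at hx hy ⊢
  fin_cases i
  · have h1 : x 1 = y 1 := by simpa [Fin.removeNth] using congrFun hxy 0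
    have h2 : z 1 = x 1 := by simpa [Fin.removeNth] using congrFun hzx 0
    have h3 : x 0 ≤ z 0 := by simpa using hxz
    have h4 : z 0 ≤ y 0 := by simpa using hzy
    omega
  · have h1 : x 0 = y 0 := by simpa [Fin.removeNth] using congrFun hxy 0
    have h2 : z 0 = x 0 := by simpa [Fin.removeNth] using congrFun hzx 0
    have h3 : x 1 ≤ z 1 := by simpa using hxz
    have h4 : z 1 ≤ y 1 := by simpa using hzy
    omega

/-- The occupied columns of a daisy: `{1, …, s}`, plus column `s + 1` when the extra line is a
non-empty column (`s' = s + 1`, `e ≥ 1`). [cite: MaininiPiovanoSchmidtStefanelli2019, §2 (daisies)] -/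
theorem image_daisy_apply_zero {s s' e : ℕ} (hs : 1 ≤ s) (he : e < s') :
    (daisy s s' e).image (fun z => z 0) =
      Icc (1 : ℤ) (if s' = s ∨ e = 0 then (s : ℤ) else (s : ℤ) + 1) := by
  ext t
  simp only [mem_image, mem_Icc]
  constructor
  · rintro ⟨z, hz, rfl⟩
    rw [mem_daisy] at hz
    split_ifs with h <;> omega
  · intro ht
    refine ⟨![t, 1], ?_, by simp⟩
    rw [mem_daisy]
    simp only [Matrix.cons_val_zero, Matrix.cons_val_one]
    split_ifs at ht with h <;> omega

/-- The occupied rows of a daisy: `{1, …, s'}`, plus row `s' + 1` when the extra line is a non-empty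
row (`s' = s`, `e ≥ 1`). [cite: MaininiPiovanoSchmidtStefanelli2019, §2 (daisies)] -/
theorem image_daisy_apply_one {s s' e : ℕ} (hs : 1 ≤ s) (he : e < s') :
    (daisy s s' e).image (fun z => z 1) =
      Icc (1 : ℤ) (if s' = s ∧ e ≠ 0 then (s' : ℤ) + 1 else (s' : ℤ)) := by
  ext t
  simp only [mem_image, mem_Icc]
  constructor
  · rintro ⟨z, hz, rfl⟩
    rw [mem_daisy] at hz
    split_ifs with h <;> omega
  · intro ht
    refine ⟨![1, t], ?_, by simp⟩
    rw [mem_daisy]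
    simp only [Matrix.cons_val_zero, Matrix.cons_val_one]
    split_ifs at ht with h <;> omega

/-- **The edge perimeter of a daisy**: `#Θ₂(R(s,s') ∪ L_e) = 2(s + s') + 2·[e ≠ 0]` — twice the
number of occupied columns plus rows, as every row and column of a daisy is an interval.
[cite: MaininiPiovanoSchmidtStefanelli2019, §2 (daisies are EIP² minimizers)] -/
theorem card_boundaryPairs_daisy {s s' e : ℕ} (hs : 1 ≤ s) (hs' : s' = s ∨ s' = s + 1) (he : e < s') :
    #(boundaryPairs (daisy s s' e)) = 2 * (s + s') + (if e = 0 then 0 else 2) := by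
  have hcols : #((daisy s s' e).image fun z => z 0) = (if s' = s ∨ e = 0 then s else s + 1) := by
    rw [image_daisy_apply_zero hs he, Int.card_Icc]
    split_ifs <;> omega
  have hrows : #((daisy s s' e).image fun z => z 1) = (if s' = s ∧ e ≠ 0 then s' + 1 else s') := by
    rw [image_daisy_apply_one hs he, Int.card_Icc]
    split_ifs <;> omega
  have h : #(boundaryPairs (daisy s s' e)) = 2 * ∑ i : Fin 2, #(dropCoord i (daisy s s' e)) :=
    card_boundaryPairs_eq_two_mul_sum_card_dropCoord_of_isLineConvex _ (isLineConvex_daisy s s' e)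
  simp only [Fin.sum_univ_two] at h
  have h0 := card_dropCoord_zero_eq (daisy s s' e)
  have h1 := card_dropCoord_one_eq (daisy s s' e)
  rcases hs' with h' | h' <;> split_ifs at hcols hrows ⊢ <;> omega

/-! ### The arithmetic of `⌈2√n⌉` on daisy numbers -/

/-- `⌈2√N⌉ = k + 1` as soon as `k² < 4N ≤ (k+1)²`. [folklore] -/
private theorem natCeil_two_sqrt_eq {N k : ℕ} (h1 : 4 * N ≤ (k + 1) ^ 2) (h2 : k ^ 2 < 4 * N) :
    ⌈2 * Real.sqrt (N : ℝ)⌉₊ = k + 1 := by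
  have h4 : Real.sqrt 4 = 2 := by
    rw [show (4 : ℝ) = 2 ^ 2 by norm_num, Real.sqrt_sq (by norm_num : (0 : ℝ) ≤ 2)]
  have hsq : 2 * Real.sqrt (N : ℝ) = Real.sqrt (4 * N) := by
    rw [Real.sqrt_mul (by norm_num : (0 : ℝ) ≤ 4), h4]
  rw [Nat.ceil_eq_iff (by omega : k + 1 ≠ 0), Nat.add_sub_cancel, hsq]
  constructor
  · calc (k : ℝ) = Real.sqrt ((k : ℝ) ^ 2) := (Real.sqrt_sq (Nat.cast_nonneg k)).symm
      _ < Real.sqrt (4 * N) := Real.sqrt_lt_sqrt (by positivity) (by exact_mod_cast h2)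
  · calc Real.sqrt (4 * (N : ℝ)) ≤ Real.sqrt (((k + 1 : ℕ) : ℝ) ^ 2) :=
          Real.sqrt_le_sqrt (by exact_mod_cast h1)
      _ = ((k + 1 : ℕ) : ℝ) := Real.sqrt_sq (Nat.cast_nonneg _)

/-- **`⌈2√(ss' + e)⌉ = s + s' + [e ≠ 0]`** for daisy parameters (`s ≥ 1`, `s' ∈ {s, s+1}`, `e < s'`):
the four cases `n = s²`, `s² < n < s² + s`, `n = s² + s`, `s² + s < n < (s+1)²`.
[cite: MaininiPiovanoSchmidtStefanelli2019, §2 (daisies are EIP² minimizers, #Θ₂ = 2⌈2√d⌉)] -/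
theorem ceil_two_sqrt_daisy {s s' e : ℕ} (hs : 1 ≤ s) (hs' : s' = s ∨ s' = s + 1) (he : e < s') :
    ⌈2 * Real.sqrt ((s * s' + e : ℕ) : ℝ)⌉₊ = s + s' + (if e = 0 then 0 else 1) := by
  rcases hs' with h' | h' <;> rw [h'] at he ⊢ <;> split_ifs with h0
  · -- `n = s²`
    rw [h0, show s + s + 0 = (2 * s - 1) + 1 by omega]
    apply natCeil_two_sqrt_eq
    · rw [show 2 * s - 1 + 1 = 2 * s by omega]
      nlinarith
    · zify [show 1 ≤ 2 * s by omega]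
      nlinarith
  · -- `s² < n < s² + s`
    rw [show s + s + 1 = (2 * s) + 1 by omega]
    have h1 : 1 ≤ e := Nat.one_le_iff_ne_zero.mpr h0
    apply natCeil_two_sqrt_eq
    · nlinarith
    · nlinarith
  · -- `n = s² + s`
    rw [h0, show s + (s + 1) + 0 = (2 * s) + 1 by omega]
    apply natCeil_two_sqrt_eq
    · nlinarith
    · nlinarith
  · -- `s² + s < n < (s + 1)²`
    rw [show s + (s + 1) + 1 = (2 * s + 1) + 1 by omega]
    have h1 : 1 ≤ e := Nat.one_le_iff_ne_zero.mpr h0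
    have h2 : e ≤ s := by omega
    apply natCeil_two_sqrt_eq
    · nlinarith
    · nlinarith

/-- Every `n ≥ 1` is a daisy number: `n = ss' + e` with `s = ⌊√n⌋ ≥ 1`, `s' ∈ {s, s+1}`, `e < s'`.
[cite: MaininiPiovanoSchmidtStefanelli2019, §2 (for any d there is a daisy D_d)] -/
theorem exists_daisy_params {n : ℕ} (hn : 1 ≤ n) :
    ∃ s s' e : ℕ, 1 ≤ s ∧ (s' = s ∨ s' = s + 1) ∧ e < s' ∧ s * s' + e = n := by
  have h1 : Nat.sqrt n ^ 2 ≤ n := Nat.sqrt_le' n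
  have h2 : n < (Nat.sqrt n + 1) ^ 2 := Nat.lt_succ_sqrt' n
  have h3 : 0 < Nat.sqrt n := Nat.sqrt_pos.mpr (by omega)
  set s := Nat.sqrt n with hsdef
  have hs : 1 ≤ s := h3
  obtain ⟨q, hq⟩ : ∃ q, q = s * s := ⟨_, rfl⟩
  have h1' : q ≤ n := by rw [hq]; nlinarith
  have h2' : n < q + 2 * s + 1 := by rw [hq]; nlinarith
  by_cases hr : n - q < s
  · refine ⟨s, s, n - q, hs, Or.inl rfl, hr, ?_⟩
    rw [← hq]; omega
  · refine ⟨s, s + 1, n - q - s, hs, Or.inr rfl, by omega, ?_⟩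
    rw [Nat.mul_succ, ← hq]; omega

/-! ### The results -/

/-- The empty configuration has no boundary pairs. [folklore] -/
private theorem boundaryPairs_empty {d : ℕ} : boundaryPairs (∅ : Finset (Site d)) = ∅ := by
  simp [boundaryPairs]

/-- **[MPS14] Proposition 4.3 / [MPSS19] §2: daisies are `EIP²` minimizers.**  For every `n` there are
daisy parameters `s' ∈ {s, s+1}`, `e < s'`, `ss' + e = n` such that the daisy `R(s,s') ∪ L_e` has
exactly `n` points, edge perimeter exactly `2⌈2√n⌉` (equivalently `⌊2n − 2√n⌋` unit bonds), and is an
`EIP²` minimizer.  (`n = 0`: the empty daisy `R(0,1)`, a minimizer by convention.)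
[cite: MaininiPiovanoSchmidtStefanelli2019, §2 (existence of daisy minimizers D_d, recalled from [MPS14]); MaininiPiovanoStefanelli2014, Proposition 4.3] -/
theorem exists_daisy_isEIPMinimizer (n : ℕ) :
    ∃ s s' e : ℕ, (s' = s ∨ s' = s + 1) ∧ e < s' ∧ #(daisy s s' e) = n ∧
      #(boundaryPairs (daisy s s' e)) = 2 * ⌈2 * Real.sqrt (n : ℝ)⌉₊ ∧
        IsEIPMinimizer (daisy s s' e) := by
  -- the perimeter identity for honest daisy parameters
  have main : ∀ s s' e : ℕ, 1 ≤ s → (s' = s ∨ s' = s + 1) → e < s' →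
      #(boundaryPairs (daisy s s' e)) = 2 * ⌈2 * Real.sqrt ((#(daisy s s' e) : ℕ) : ℝ)⌉₊ := by
    intro s s' e hs hs' he
    rw [card_boundaryPairs_daisy hs hs' he, card_daisy, ceil_two_sqrt_daisy hs hs' he]
    split_ifs <;> omega
  -- a set realising the lower bound is a minimizer
  have minim : ∀ D : Finset (Site 2),
      #(boundaryPairs D) = 2 * ⌈2 * Real.sqrt ((#D : ℕ) : ℝ)⌉₊ → IsEIPMinimizer D := by
    intro D hD C' hC'
    rw [hD, ← hC']
    exact two_mul_ceil_two_sqrt_le_card_boundaryPairs C'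
  rcases Nat.eq_zero_or_pos n with rfl | hn
  · refine ⟨0, 1, 0, Or.inr rfl, Nat.zero_lt_one, by rw [card_daisy], ?_, ?_⟩
    · have h0 : daisy 0 1 0 = ∅ := by
        rw [← card_eq_zero, card_daisy]
      rw [h0, boundaryPairs_empty]
      simp
    · apply minim
      have h0 : daisy 0 1 0 = ∅ := by
        rw [← card_eq_zero, card_daisy]
      rw [h0, boundaryPairs_empty]
      simp
  · obtain ⟨s, s', e, hs, hs', he, hsum⟩ := exists_daisy_params hn
    have hcard : #(daisy s s' e) = n := by rw [card_daisy, hsum]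
    refine ⟨s, s', e, hs', he, hcard, ?_, minim _ (main s s' e hs hs' he)⟩
    rw [main s s' e hs hs' he, hcard]

/-- **The edge-isoperimetric problem in `ℤ²` solved: `EIP²(n) = 2⌈2√n⌉`.**  A finite `C ⊂ ℤ²` is an
`EIP²` minimizer if and only if its edge perimeter equals `2⌈2√#C⌉` ([MPSS19] §2, eq. "equivalent to
`#Θ₂(E_d) = 2⌈2√d⌉`").
[cite: MaininiPiovanoSchmidtStefanelli2019, §2 (characterisation #Θ₂(E_d) = 2⌈2√d⌉, recalled from [MPS14]); HararyHarborth1976] -/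
theorem isEIPMinimizer_iff_card_boundaryPairs_eq (C : Finset (Site 2)) :
    IsEIPMinimizer C ↔ #(boundaryPairs C) = 2 * ⌈2 * Real.sqrt (#C : ℝ)⌉₊ := by
  obtain ⟨s, s', e, -, -, hcard, hbp, -⟩ := exists_daisy_isEIPMinimizer #C
  constructor
  · intro h
    refine le_antisymm ?_ (two_mul_ceil_two_sqrt_le_card_boundaryPairs C)
    rw [← hbp]
    exact h _ hcard
  · intro h C' hC'
    rw [h, ← hC']
    exact two_mul_ceil_two_sqrt_le_card_boundaryPairs C'

/-- `√n ≤ n` for a natural number `n`. [folklore] -/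
private theorem sqrt_natCast_le_self (n : ℕ) : Real.sqrt (n : ℝ) ≤ n := by
  rcases Nat.eq_zero_or_pos n with rfl | hn
  · simp
  · have h1 : (1 : ℝ) ≤ n := by exact_mod_cast hn
    calc Real.sqrt (n : ℝ) ≤ Real.sqrt ((n : ℝ) ^ 2) := Real.sqrt_le_sqrt (by nlinarith)
      _ = n := Real.sqrt_sq (by positivity)

/-- `⌈2√n⌉ ≤ 2n`. [folklore] -/
private theorem natCeil_two_sqrt_le (n : ℕ) : ⌈2 * Real.sqrt (n : ℝ)⌉₊ ≤ 2 * n := by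
  refine Nat.ceil_le.mpr ?_
  push_cast
  linarith [sqrt_natCast_le_self n]

/-- **`β(n) = ⌊2n − 2√n⌋ = 2n − ⌈2√n⌉`** ([MPS14] §4; the identity behind [MPSS19] §2 "equivalent to
`#Θ₂(E_d) = 4d − 2⌊2d − 2√d⌋`, i.e., to `#Θ₂(E_d) = 2⌈2√d⌉`").
[cite: MaininiPiovanoSchmidtStefanelli2019, §2 (4d − 2⌊2d−2√d⌋ = 2⌈2√d⌉); MaininiPiovanoStefanelli2014, §4 (β(n))] -/
theorem natFloor_two_mul_sub_two_sqrt (n : ℕ) :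
    ⌊2 * (n : ℝ) - 2 * Real.sqrt (n : ℝ)⌋₊ = 2 * n - ⌈2 * Real.sqrt (n : ℝ)⌉₊ := by
  have hc : ⌈2 * Real.sqrt (n : ℝ)⌉₊ ≤ 2 * n := natCeil_two_sqrt_le n
  have h0 : (0 : ℝ) ≤ 2 * Real.sqrt (n : ℝ) := by positivity
  have hnn : (0 : ℝ) ≤ 2 * (n : ℝ) - 2 * Real.sqrt (n : ℝ) := by
    linarith [sqrt_natCast_le_self n]
  rw [Nat.floor_eq_iff hnn]
  have hle : 2 * Real.sqrt (n : ℝ) ≤ ⌈2 * Real.sqrt (n : ℝ)⌉₊ := Nat.le_ceil _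
  have hlt : (⌈2 * Real.sqrt (n : ℝ)⌉₊ : ℝ) < 2 * Real.sqrt (n : ℝ) + 1 := Nat.ceil_lt_add_one h0
  rw [Nat.cast_sub hc]
  push_cast
  constructor <;> linarith

/-- **Every finite `C ⊂ ℤ²` has at most `⌊2n − 2√n⌋` unit bonds** (`n = #C`; here bonds are counted
as ORDERED adjacent pairs, i.e. `2b(C) ≤ 2⌊2n − 2√n⌋`) — the Harary–Harborth bound in the bond form of
[MPS14] (`E ≥ −β(n)` on `ℤ²`).
[cite: MaininiPiovanoStefanelli2014, Proposition 4.3 and Theorem 5.1 (β(n) is the ground-state bond number); HararyHarborth1976] -/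
theorem card_adjPairs_le_two_mul_natFloor (C : Finset (Site 2)) :
    #((C ×ˢ C).filter fun p => (zdGraph 2).Adj p.1 p.2) ≤
      2 * ⌊2 * (#C : ℝ) - 2 * Real.sqrt (#C : ℝ)⌋₊ := by
  have h1 := card_boundaryPairs_add_card_adjPairs C
  have h2 := two_mul_ceil_two_sqrt_le_card_boundaryPairs C
  have h3 := natCeil_two_sqrt_le #C
  rw [natFloor_two_mul_sub_two_sqrt]
  omega

/-- **The printed bond characterisation**: `C ⊂ ℤ²` "solves (EIP²) if and only if the number of unit
bonds of `C` (i.e., `½ #{(x, y) ∈ C × C : |x − y| = 1}`) is equal to `⌊2#C − 2√#C⌋`" — here with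
ordered pairs, `#{(x, y) ∈ C × C : x ∼ y} = 2⌊2#C − 2√#C⌋`.
[cite: MaininiPiovanoSchmidtStefanelli2019, §2 (E_d solves EIP² iff b = ⌊2d − 2√d⌋, recalled from [MPS14]); MaininiPiovanoStefanelli2014, Theorem 5.1] -/
theorem isEIPMinimizer_iff_card_adjPairs_eq (C : Finset (Site 2)) :
    IsEIPMinimizer C ↔
      #((C ×ˢ C).filter fun p => (zdGraph 2).Adj p.1 p.2) =
        2 * ⌊2 * (#C : ℝ) - 2 * Real.sqrt (#C : ℝ)⌋₊ := by
  rw [isEIPMinimizer_iff_card_boundaryPairs_eq, natFloor_two_mul_sub_two_sqrt]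
  have h1 := card_boundaryPairs_add_card_adjPairs C
  have h3 := natCeil_two_sqrt_le #C
  omega

/-! ### Minimizers are convex by rows and columns ([MPS14] Proposition 6.3) -/

section NotConvex

variable {n : ℕ}

/-- **A lattice line NOT met in an interval carries two boundary pairs of the same sense.**  If `A`
is not line-convex in direction `i`, the lines of direction `eᵢ` meeting `A` inject STRICTLY into the
boundary pairs of sense `(i, +)`: besides the top of every line, the last point of `A` below a gap is
a further boundary pair.  (The counting behind "a non-convex row or column costs extra perimeter".)
[cite: MaininiPiovanoStefanelli2014, Proposition 6.3 (ground states are convex by rows and columns)] -/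
theorem card_dropCoord_lt_card_filter_boundaryPairs_of_not_isLineConvex {i : Fin (n + 1)}
    {A : Finset (Site (n + 1))} (hA : ¬ IsLineConvex i A) :
    #(dropCoord i A) < #{t ∈ boundaryPairs A | t.2 = (i, true)} := by
  classical
  unfold IsLineConvex at hA
  push Not at hA
  obtain ⟨x, hx, y, hy, hxy, z, hzx, hxz, hzy, hz⟩ := hA
  have hstep : ∀ w : Site (n + 1), (w + unitStep i true) i = w i + 1 := fun w => by
    simp [unitStep_apply]
  -- the line through `x`, and its part strictly below the missing point `z`
  set F := A.filter (fun w => Fin.removeNth i w = Fin.removeNth i x) with hF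
  set S := F.filter (fun w => w i < z i) with hS
  have hxz' : x i < z i := by
    rcases lt_or_eq_of_le hxz with h | h
    · exact h
    · exact absurd (site_eq_of_removeNth_eq_of_apply_eq hzx.symm h ▸ hx) hz
  have hxS : x ∈ S := by simp [hS, hF, hx, hxz']
  have hyF : y ∈ F := by simp [hF, hy, hxy]
  obtain ⟨m, hmS, hmmax⟩ := S.exists_max_image (fun w => w i) ⟨x, hxS⟩
  obtain ⟨M, hMF, hMmax⟩ := F.exists_max_image (fun w => w i) ⟨y, hyF⟩
  have hmF : m ∈ F := (mem_filter.1 hmS).1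
  have hmA : m ∈ A := (mem_filter.1 hmF).1
  have hmproj : Fin.removeNth i m = Fin.removeNth i x := (mem_filter.1 hmF).2
  have hmz : m i < z i := (mem_filter.1 hmS).2
  have hMA : M ∈ A := (mem_filter.1 hMF).1
  have hMproj : Fin.removeNth i M = Fin.removeNth i x := (mem_filter.1 hMF).2
  have hMy : y i ≤ M i := hMmax y hyF
  -- `(m, i, +)` is a boundary pair: its successor is either below `z` (contradicting maximality) or `z`
  have hm_out : m + unitStep i true ∉ A := by
    intro hin
    have hinF : m + unitStep i true ∈ F := by
      rw [hF, mem_filter]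
      exact ⟨hin, by rw [removeNth_add_unitStep_eq, hmproj]⟩
    rcases lt_or_eq_of_le (show m i + 1 ≤ z i by omega) with hlt | heq
    · have hinS : m + unitStep i true ∈ S := by
        rw [hS, mem_filter]
        exact ⟨hinF, by rw [hstep]; exact hlt⟩
      have := hmmax _ hinS
      rw [hstep] at this
      omega
    · apply hz
      have : m + unitStep i true = z :=
        site_eq_of_removeNth_eq_of_apply_eq (by rw [removeNth_add_unitStep_eq, hmproj, hzx])
          (by rw [hstep, heq])
      rw [← this]
      exact hin
  have hmM : m i < M i := by omega
  -- the boundary pairs of sense `(i, +)` other than `(m, i, +)` still cover every line (by its top)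
  set B := {t ∈ boundaryPairs A | t.2 = (i, true)} with hB
  have hmB : (m, i, true) ∈ B := by
    rw [hB, mem_filter, mem_boundaryPairs]
    exact ⟨⟨hmA, hm_out⟩, rfl⟩
  have hsurj : Set.SurjOn (fun t : Site (n + 1) × Fin (n + 1) × Bool => Fin.removeNth i t.1)
      ↑(B.erase (m, i, true)) ↑(dropCoord i A) := by
    intro w hw
    rw [mem_coe, mem_dropCoord_iff] at hw
    obtain ⟨x₀, hx₀, rfl⟩ := hw
    set F₀ := A.filter (fun w => Fin.removeNth i w = Fin.removeNth i x₀) with hF₀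
    obtain ⟨M₀, hM₀F, hM₀max⟩ := F₀.exists_max_image (fun w => w i) ⟨x₀, by simp [hF₀, hx₀]⟩
    have hM₀A : M₀ ∈ A := (mem_filter.1 hM₀F).1
    have hM₀proj : Fin.removeNth i M₀ = Fin.removeNth i x₀ := (mem_filter.1 hM₀F).2
    have hM₀out : M₀ + unitStep i true ∉ A := by
      intro hin
      have hinF : M₀ + unitStep i true ∈ F₀ := by
        rw [hF₀, mem_filter]
        exact ⟨hin, by rw [removeNth_add_unitStep_eq, hM₀proj]⟩
      have := hM₀max _ hinF
      rw [hstep] at this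
      omega
    refine ⟨(M₀, i, true), ?_, hM₀proj⟩
    rw [mem_coe, mem_erase]
    refine ⟨fun h => ?_, by rw [hB, mem_filter, mem_boundaryPairs]; exact ⟨⟨hM₀A, hM₀out⟩, rfl⟩⟩
    -- `(M₀, i, +) = (m, i, +)` is impossible: `m` is not the top of its line, `M` lies above it
    have hM₀m : M₀ = m := (Prod.mk.inj h).1
    have hMF₀ : M ∈ F₀ := by
      rw [hF₀, mem_filter]
      refine ⟨hMA, ?_⟩
      rw [hMproj, ← hmproj, ← hM₀m, hM₀proj]
    have := hM₀max M hMF₀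
    rw [hM₀m] at this
    omega
  have hcard := card_le_card_of_surjOn _ hsurj
  rw [card_erase_of_mem hmB] at hcard
  have hBpos : 0 < #B := card_pos.2 ⟨_, hmB⟩
  omega

end NotConvex

/-- **[MPS14] Proposition 6.3 in edge-isoperimetric form: `EIP²` minimizers are convex by rows and
columns.**  Every row and every column of an `EIP²` minimizer `C ⊂ ℤ²` is a lattice interval — a
non-convex line would carry at least one extra boundary pair beyond the `2⌈2√#C⌉` of a minimizer.
This is also the planar content of Mainini–Schmidt's Corollary 3.3 (the one-dimensional sections of
a two-dimensional minimizer are one-dimensional minimizers, i.e. intervals).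
[cite: MaininiPiovanoStefanelli2014, Proposition 6.3; MaininiSchmidt2020, Corollary 3.3 (d = 2)] -/
theorem IsEIPMinimizer.isLineConvex {C : Finset (Site 2)} (hC : IsEIPMinimizer C) (i : Fin 2) :
    IsLineConvex i C := by
  by_contra h
  have hle : ∀ (j : Fin 2) (b : Bool), #(dropCoord j C) ≤ #{t ∈ boundaryPairs C | t.2 = (j, b)} :=
    fun j b => card_dropCoord_le_card_filter_boundaryPairs j b C
  have hdecomp : #(boundaryPairs C) = ∑ c : Fin 2 × Bool, #{t ∈ boundaryPairs C | t.2 = c} :=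
    card_eq_sum_card_fiberwise fun t _ => mem_coe.2 (mem_univ t.2)
  rw [Fintype.sum_prod_type] at hdecomp
  simp only [Fin.sum_univ_two, Fintype.sum_bool] at hdecomp
  have h1 : #C ≤ #(dropCoord 0 C) * #(dropCoord 1 C) := card_le_card_dropCoord_mul_two C
  have h3 := ceil_two_sqrt_le_add h1
  have hmin := (isEIPMinimizer_iff_card_boundaryPairs_eq C).1 hC
  have h00 := hle 0 true
  have h01 := hle 0 false
  have h10 := hle 1 true
  have h11 := hle 1 false
  -- (the ascriptions pin the boundary-pair sets of `C ⊂ ℤ²` syntactically, for `omega`)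
  obtain rfl | rfl : i = 0 ∨ i = 1 := by fin_cases i <;> simp
  · have hlt : #(dropCoord 0 C) < #{t ∈ boundaryPairs C | t.2 = ((0 : Fin 2), true)} :=
      card_dropCoord_lt_card_filter_boundaryPairs_of_not_isLineConvex h
    omega
  · have hlt : #(dropCoord 1 C) < #{t ∈ boundaryPairs C | t.2 = ((1 : Fin 2), true)} :=
      card_dropCoord_lt_card_filter_boundaryPairs_of_not_isLineConvex h
    omega

/-! ### [MS20] Lemma 3.5 in the plane: the slab-deficient squares `P_{ℓ,2,p}` ARE minimizers -/

/-- Membership in `P_{ℓ,2,p} = {1, …, ℓ − p} × {1, …, ℓ}` (`slabConfig 2 ℓ p` of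
`EdgeIsoperimetricFluctuations.lean`), in coordinates. [cite: MaininiSchmidt2020, Lemma 3.5 (P_{ℓ,d,p})] -/
theorem mem_slabConfig_two {ℓ p : ℕ} {z : Site 2} :
    z ∈ slabConfig 2 ℓ p ↔ 1 ≤ z 0 ∧ z 0 ≤ (ℓ : ℤ) - p ∧ 1 ≤ z 1 ∧ z 1 ≤ ℓ := by
  simp [slabConfig, Fintype.mem_piFinset, Fin.forall_fin_two, and_assoc]

/-- `#P_{ℓ,2,p} = (ℓ − p)·ℓ`. [cite: MaininiSchmidt2020, Lemma 3.5 (P_{ℓ,d,p})] -/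
theorem card_slabConfig_two (ℓ p : ℕ) : #(slabConfig 2 ℓ p) = (ℓ - p) * ℓ := by
  have h : #(slabConfig 2 ℓ p) = ((ℓ : ℤ) - p + 1 - 1).toNat * (((ℓ : ℤ) + 1 - 1).toNat) := by
    simp [slabConfig, Fintype.card_piFinset, Fin.prod_univ_two, Int.card_Icc]
  rw [h]
  have h1 : ((ℓ : ℤ) - p + 1 - 1).toNat = ℓ - p := by omega
  have h2 : ((ℓ : ℤ) + 1 - 1).toNat = ℓ := by omega
  rw [h1, h2]

/-- `P_{ℓ,2,p}` is line-convex in both directions (a lattice rectangle).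
[cite: MaininiSchmidt2020, Lemma 3.5 (P_{ℓ,d,p})] -/
theorem isLineConvex_slabConfig_two (ℓ p : ℕ) (i : Fin 2) : IsLineConvex i (slabConfig 2 ℓ p) := by
  intro x hx y hy hxy z hzx hxz hzy
  rw [mem_slabConfig_two] at hx hy ⊢
  fin_cases i
  · have h1 : x 1 = y 1 := by simpa [Fin.removeNth] using congrFun hxy 0
    have h2 : z 1 = x 1 := by simpa [Fin.removeNth] using congrFun hzx 0
    have h3 : x 0 ≤ z 0 := by simpa using hxz
    have h4 : z 0 ≤ y 0 := by simpa using hzy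
    omega
  · have h1 : x 0 = y 0 := by simpa [Fin.removeNth] using congrFun hxy 0
    have h2 : z 0 = x 0 := by simpa [Fin.removeNth] using congrFun hzx 0
    have h3 : x 1 ≤ z 1 := by simpa using hxz
    have h4 : z 1 ≤ y 1 := by simpa using hzy
    omega

/-- The columns of `P_{ℓ,2,p}` are `{1, …, ℓ − p}` (`p < ℓ`). [cite: MaininiSchmidt2020, Lemma 3.5 (P_{ℓ,d,p})] -/
theorem image_slabConfig_two_apply_zero {ℓ p : ℕ} (h : p < ℓ) :
    (slabConfig 2 ℓ p).image (fun z => z 0) = Icc (1 : ℤ) ((ℓ : ℤ) - p) := by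
  ext t
  simp only [mem_image, mem_Icc]
  constructor
  · rintro ⟨z, hz, rfl⟩
    rw [mem_slabConfig_two] at hz
    omega
  · intro ht
    refine ⟨![t, 1], ?_, by simp⟩
    rw [mem_slabConfig_two]
    simp only [Matrix.cons_val_zero, Matrix.cons_val_one]
    omega

/-- The rows of `P_{ℓ,2,p}` are `{1, …, ℓ}` (`p < ℓ`). [cite: MaininiSchmidt2020, Lemma 3.5 (P_{ℓ,d,p})] -/
theorem image_slabConfig_two_apply_one {ℓ p : ℕ} (h : p < ℓ) :
    (slabConfig 2 ℓ p).image (fun z => z 1) = Icc (1 : ℤ) (ℓ : ℤ) := by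
  ext t
  simp only [mem_image, mem_Icc]
  constructor
  · rintro ⟨z, hz, rfl⟩
    rw [mem_slabConfig_two] at hz
    omega
  · intro ht
    refine ⟨![1, t], ?_, by simp⟩
    rw [mem_slabConfig_two]
    simp only [Matrix.cons_val_zero, Matrix.cons_val_one]
    omega

/-- The edge perimeter of `P_{ℓ,2,p}` is `2((ℓ − p) + ℓ)` (`p < ℓ`): columns plus rows, twice.
[cite: MaininiSchmidt2020, Lemma 3.5 (P_{ℓ,d,p})] -/
theorem card_boundaryPairs_slabConfig_two {ℓ p : ℕ} (h : p < ℓ) :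
    #(boundaryPairs (slabConfig 2 ℓ p)) = 2 * ((ℓ - p) + ℓ) := by
  have hb : #(boundaryPairs (slabConfig 2 ℓ p)) = 2 * ∑ i : Fin 2, #(dropCoord i (slabConfig 2 ℓ p)) :=
    card_boundaryPairs_eq_two_mul_sum_card_dropCoord_of_isLineConvex _ (isLineConvex_slabConfig_two ℓ p)
  simp only [Fin.sum_univ_two] at hb
  have h0 := card_dropCoord_zero_eq (slabConfig 2 ℓ p)
  have h1 := card_dropCoord_one_eq (slabConfig 2 ℓ p)
  have hr : #((slabConfig 2 ℓ p).image fun z => z 1) = ℓ := by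
    rw [image_slabConfig_two_apply_one h, Int.card_Icc]; omega
  have hc : #((slabConfig 2 ℓ p).image fun z => z 0) = ℓ - p := by
    rw [image_slabConfig_two_apply_zero h, Int.card_Icc]; omega
  omega

/-- **[MS20] Lemma 3.5 for `d = 2`, PROVED**: for `ℓ ≥ 1` and `1 ≤ p ≤ ⌊h_{ℓ,2}⌋ = ⌊ℓ^{2^{1−2}}⌋ = ⌊√ℓ⌋`
the slab-deficient square `P_{ℓ,2,p} = {1,…,ℓ−p} × {1,…,ℓ}` is an `EIP²` minimizer.  This is exactly
the `d = 2` instance of the named fact `MaininiSchmidt2020_lemma35` of `EdgeIsoperimetricFluctuations.lean`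
(stated there for all `d ≥ 2`, hypotheses copied verbatim), now a theorem: `#Θ₂(P) = 2(2ℓ − p)` and
`⌈2√((ℓ−p)ℓ)⌉ = 2ℓ − p` precisely because `(p + 1)² < 4ℓ`, which `p ≤ √ℓ` guarantees (`ℓ ≥ 2`;
for `ℓ = 1` the configuration is empty). [cite: MaininiSchmidt2020, Lemma 3.5 (d = 2)] -/
theorem MaininiSchmidt2020_lemma35_two (ℓ p : ℕ) (hℓ : 1 ≤ ℓ) (hp : 1 ≤ p)
    (hpℓ : p ≤ ⌊(ℓ : ℝ) ^ ((2 : ℝ) ^ (1 - ((2 : ℕ) : ℝ)))⌋₊) :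
    IsEIPMinimizer (slabConfig 2 ℓ p) := by
  -- `p ≤ ⌊√ℓ⌋`, so `p² ≤ ℓ`
  have hexp : (2 : ℝ) ^ (1 - ((2 : ℕ) : ℝ)) = 1 / 2 := by
    rw [show (1 : ℝ) - ((2 : ℕ) : ℝ) = ((-1 : ℤ) : ℝ) by norm_num, Real.rpow_intCast]
    norm_num
  have hsqrt : (ℓ : ℝ) ^ ((2 : ℝ) ^ (1 - ((2 : ℕ) : ℝ))) = Real.sqrt ℓ := by
    rw [hexp, Real.sqrt_eq_rpow]
  have hpr : (p : ℝ) ≤ Real.sqrt ℓ := by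
    have h1 : ((⌊(ℓ : ℝ) ^ ((2 : ℝ) ^ (1 - ((2 : ℕ) : ℝ)))⌋₊ : ℕ) : ℝ) ≤ Real.sqrt ℓ := by
      rw [← hsqrt]
      exact Nat.floor_le (by positivity)
    exact le_trans (by exact_mod_cast hpℓ) h1
  have hsq : p * p ≤ ℓ := by
    have h2 : (p : ℝ) ^ 2 ≤ (Real.sqrt ℓ) ^ 2 := pow_le_pow_left₀ (by positivity) hpr 2
    rw [Real.sq_sqrt (by positivity)] at h2
    have h3 : ((p * p : ℕ) : ℝ) ≤ ℓ := by push_cast; nlinarith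
    exact_mod_cast h3
  rcases Nat.lt_or_ge p ℓ with hlt | hge
  · -- `p < ℓ`: the rectangle `(ℓ − p) × ℓ` has perimeter `2(2ℓ − p) = 2⌈2√((ℓ − p)ℓ)⌉`
    rw [isEIPMinimizer_iff_card_boundaryPairs_eq, card_boundaryPairs_slabConfig_two hlt,
      card_slabConfig_two]
    obtain ⟨q, hq⟩ : ∃ q, ℓ - p = q + 1 := ⟨ℓ - p - 1, by omega⟩
    have hpq : p + q + 1 = ℓ := by omega
    rw [hq, show q + 1 + ℓ = (q + ℓ) + 1 by ring]
    congr 1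
    symm
    apply natCeil_two_sqrt_eq
    · nlinarith [sq_nonneg ((ℓ : ℤ) - q - 1)]
    · nlinarith
  · -- `p ≥ ℓ` forces `ℓ = p = 1`: the empty configuration
    have hempty : slabConfig 2 ℓ p = ∅ := by
      rw [← card_eq_zero, card_slabConfig_two, Nat.sub_eq_zero_of_le hge, zero_mul]
    rw [hempty]
    exact isEIPMinimizer_empty

/-! ### [MS20] Theorem 1.1 (ii) in the plane: minimizers `½·n^{3/4}` away from every Wulff square -/

section Fluctuation

open scoped symmDiff

/-- `⌊√n⌋` (`latticeRootFloor 2 n`) is characterised by `m² ≤ n < (m+1)²`.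
[cite: MaininiSchmidt2020, §1 (W_n = {1,…,⌊n^{1/d}⌋}^d)] -/
theorem latticeRootFloor_two_eq {n m : ℕ} (h1 : m ^ 2 ≤ n) (h2 : n < (m + 1) ^ 2) :
    latticeRootFloor 2 n = m := by
  have h3 := latticeRootFloor_pow_le (d := 2) (by norm_num) n
  have h4 := lt_latticeRootFloor_succ_pow (d := 2) (by norm_num) n
  have hrm : latticeRootFloor 2 n ≤ m := by
    by_contra h0
    have : (m + 1) ^ 2 ≤ latticeRootFloor 2 n ^ 2 := Nat.pow_le_pow_left (Nat.lt_of_not_le h0) 2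
    omega
  have hmr : m ≤ latticeRootFloor 2 n := by
    by_contra h0
    have : (latticeRootFloor 2 n + 1) ^ 2 ≤ m ^ 2 := Nat.pow_le_pow_left (by omega) 2
    omega
  omega

/-- **The planar slab family** `M_k = P_{ℓ,2,p} = {1,…,ℓ−p} × {1,…,ℓ}` with `t = k + 1`, `ℓ = 4t²`,
`p = 2t = √ℓ` — the lower-bound construction of [MS20] Theorem 1.1 (ii) at `d = 2`
(`p ≈ h_{ℓ,2} = ℓ^{1/2}`). [cite: MaininiSchmidt2020, Lemma 3.5 and Theorem 1.1 (ii) (d = 2)] -/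
def planarSlab (k : ℕ) : Finset (Site 2) := slabConfig 2 (4 * (k + 1) ^ 2) (2 * (k + 1))

/-- `#M_k = (4t² − 2t)·4t² = (4k² + 6k + 2)·4(k+1)²`. [cite: MaininiSchmidt2020, Lemma 3.5 (d = 2)] -/
theorem card_planarSlab (k : ℕ) : #(planarSlab k) = (4 * k ^ 2 + 6 * k + 2) * (4 * (k + 1) ^ 2) := by
  rw [planarSlab, card_slabConfig_two]
  have e : 4 * (k + 1) ^ 2 = 4 * k ^ 2 + 6 * k + 2 + 2 * (k + 1) := by ring
  rw [e, Nat.add_sub_cancel]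

/-- Membership in `M_k`: `1 ≤ z₀ ≤ 4k² + 6k + 2`, `1 ≤ z₁ ≤ 4(k+1)²`. [cite: MaininiSchmidt2020, Lemma 3.5 (d = 2)] -/
theorem mem_planarSlab {k : ℕ} {z : Site 2} :
    z ∈ planarSlab k ↔ 1 ≤ z 0 ∧ z 0 ≤ 4 * (k : ℤ) ^ 2 + 6 * k + 2 ∧ 1 ≤ z 1 ∧
      z 1 ≤ 4 * ((k : ℤ) + 1) ^ 2 := by
  rw [planarSlab, mem_slabConfig_two]
  push_cast
  constructor
  · rintro ⟨h1, h2, h3, h4⟩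
    exact ⟨h1, by nlinarith, h3, h4⟩
  · rintro ⟨h1, h2, h3, h4⟩
    exact ⟨h1, by nlinarith, h3, h4⟩

/-- **`M_k` is an `EIP²` minimizer** (`p = 2t ≤ ⌊√ℓ⌋ = 2t`, Lemma 3.5 at `d = 2`).
[cite: MaininiSchmidt2020, Lemma 3.5 (d = 2)] -/
theorem isEIPMinimizer_planarSlab (k : ℕ) : IsEIPMinimizer (planarSlab k) := by
  refine MaininiSchmidt2020_lemma35_two _ _
    (by have h : 0 < (k + 1) ^ 2 := by positivity
        omega) (by omega) ?_
  have hexp : (2 : ℝ) ^ (1 - ((2 : ℕ) : ℝ)) = 1 / 2 := by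
    rw [show (1 : ℝ) - ((2 : ℕ) : ℝ) = ((-1 : ℤ) : ℝ) by norm_num, Real.rpow_intCast]
    norm_num
  have hroot : (((4 * (k + 1) ^ 2 : ℕ) : ℝ)) ^ ((2 : ℝ) ^ (1 - ((2 : ℕ) : ℝ))) =
      ((2 * (k + 1) : ℕ) : ℝ) := by
    rw [hexp, show ((4 * (k + 1) ^ 2 : ℕ) : ℝ) = ((2 * (k + 1) : ℕ) : ℝ) ^ 2 by push_cast; ring,
      ← Real.sqrt_eq_rpow, Real.sqrt_sq (by positivity)]
  rw [hroot, Nat.floor_natCast]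

/-- `⌊√#M_k⌋ = 4t² − t − 1 = 4k² + 7k + 2`. [cite: MaininiSchmidt2020, §1 (W_n) with Lemma 3.5 (d = 2)] -/
theorem latticeRootFloor_card_planarSlab (k : ℕ) :
    latticeRootFloor 2 #(planarSlab k) = 4 * k ^ 2 + 7 * k + 2 := by
  rw [card_planarSlab]
  have e1 : (4 * k ^ 2 + 6 * k + 2) * (4 * (k + 1) ^ 2) =
      (4 * k ^ 2 + 7 * k + 2) ^ 2 + (7 * k ^ 2 + 12 * k + 4) := by ring
  have e2 : (4 * k ^ 2 + 7 * k + 2 + 1) ^ 2 =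
      (4 * k ^ 2 + 6 * k + 2) * (4 * (k + 1) ^ 2) + (k ^ 2 + 2 * k + 1) := by ring
  exact latticeRootFloor_two_eq (by omega) (by omega)

/-- **The planar slabs deviate from every window of `⌊√n⌋` rows by at least `(k+2)(4k²+6k+2)`
points**: a set `Q` whose second coordinates lie in an interval of `⌊√#M_k⌋ = 4k² + 7k + 2`
consecutive values misses at least `k + 2` of the `4(k+1)²` rows of `M_k`, each a full row of
`4k² + 6k + 2` points. [cite: MaininiSchmidt2020, Theorem 1.1 (ii) (proof: "This follows directly from Lemma 3.5"), d = 2] -/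
theorem le_card_planarSlab_sdiff_of (k : ℕ) (Q : Finset (Site 2)) (b : ℤ)
    (hQ : ∀ x ∈ Q, b ≤ x 1 ∧ x 1 < b + (4 * (k : ℤ) ^ 2 + 7 * k + 2)) :
    (k + 2) * (4 * k ^ 2 + 6 * k + 2) ≤ #(planarSlab k \ Q) := by
  classical
  -- the rows of the slab missed by `Q`
  set Y : Finset ℤ := (Icc (1 : ℤ) (4 * ((k : ℤ) + 1) ^ 2)).filter
    fun y => y ∉ Ico b (b + (4 * (k : ℤ) ^ 2 + 7 * k + 2)) with hY
  have hYcard : k + 2 ≤ #Y := by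
    have h1 := Finset.card_filter_add_card_filter_not (s := Icc (1 : ℤ) (4 * ((k : ℤ) + 1) ^ 2))
      (fun y => y ∈ Ico b (b + (4 * (k : ℤ) ^ 2 + 7 * k + 2)))
    have h2 : #((Icc (1 : ℤ) (4 * ((k : ℤ) + 1) ^ 2)).filter
        fun y => y ∈ Ico b (b + (4 * (k : ℤ) ^ 2 + 7 * k + 2))) ≤ 4 * k ^ 2 + 7 * k + 2 := by
      calc #((Icc (1 : ℤ) (4 * ((k : ℤ) + 1) ^ 2)).filter
            fun y => y ∈ Ico b (b + (4 * (k : ℤ) ^ 2 + 7 * k + 2)))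
          ≤ #(Ico b (b + (4 * (k : ℤ) ^ 2 + 7 * k + 2))) := card_le_card fun y hy => (mem_filter.1 hy).2
        _ = 4 * k ^ 2 + 7 * k + 2 := by
          rw [Int.card_Ico]
          have : b + (4 * (k : ℤ) ^ 2 + 7 * k + 2) - b = ((4 * k ^ 2 + 7 * k + 2 : ℕ) : ℤ) := by
            push_cast; ring
          rw [this, Int.toNat_natCast]
    have h3 : #(Icc (1 : ℤ) (4 * ((k : ℤ) + 1) ^ 2)) = 4 * (k + 1) ^ 2 := by
      rw [Int.card_Icc]
      have : 4 * ((k : ℤ) + 1) ^ 2 + 1 - 1 = ((4 * (k + 1) ^ 2 : ℕ) : ℤ) := by push_cast; ring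
      rw [this, Int.toNat_natCast]
    rw [h3] at h1
    rw [hY]
    have e : 4 * (k + 1) ^ 2 = 4 * k ^ 2 + 7 * k + 2 + (k + 2) := by ring
    omega
  -- the sub-rectangle `[1, 4k²+6k+2] × Y` of the slab, disjoint from `Q`
  set B : Finset (Site 2) := Fintype.piFinset ![Icc (1 : ℤ) (4 * (k : ℤ) ^ 2 + 6 * k + 2), Y]
    with hB
  have hBcard : #B = (4 * k ^ 2 + 6 * k + 2) * #Y := by
    rw [hB, Fintype.card_piFinset, Fin.prod_univ_two]
    simp only [Matrix.cons_val_zero, Matrix.cons_val_one, Int.card_Icc]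
    have : 4 * (k : ℤ) ^ 2 + 6 * k + 2 + 1 - 1 = ((4 * k ^ 2 + 6 * k + 2 : ℕ) : ℤ) := by
      push_cast; ring
    rw [this, Int.toNat_natCast]
  have hBsub : B ⊆ planarSlab k \ Q := by
    intro x hx
    rw [hB, Fintype.mem_piFinset] at hx
    have hx0 := hx 0
    have hx1 := hx 1
    simp only [Matrix.cons_val_zero, Matrix.cons_val_one, mem_Icc] at hx0 hx1
    have hx1' : x 1 ∈ Y := hx1
    rw [hY, mem_filter, mem_Icc, mem_Ico] at hx1'
    rw [Finset.mem_sdiff, mem_planarSlab]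
    exact ⟨⟨hx0.1, hx0.2, hx1'.1.1, hx1'.1.2⟩, fun hxQ => hx1'.2 (hQ x hxQ)⟩
  calc (k + 2) * (4 * k ^ 2 + 6 * k + 2) = (4 * k ^ 2 + 6 * k + 2) * (k + 2) := by ring
    _ ≤ (4 * k ^ 2 + 6 * k + 2) * #Y := Nat.mul_le_mul_left _ hYcard
    _ = #B := hBcard.symm
    _ ≤ _ := card_le_card hBsub

/-- `½·(#M_k)^{3/4} ≤ (k+2)(4k²+6k+2)` (`#M_k ≤ (2t)⁴`, `(k+2)(4k²+6k+2) ≥ 4t³`).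
[cite: MaininiSchmidt2020, Theorem 1.1 (ii) (d = 2)] -/
theorem half_mul_rpow_card_planarSlab_le (k : ℕ) :
    (1 / 2 : ℝ) * (#(planarSlab k) : ℝ) ^ ((3 : ℝ) / 4) ≤ (((k + 2) * (4 * k ^ 2 + 6 * k + 2) : ℕ) : ℝ) := by
  rw [card_planarSlab]
  have hn : (4 * k ^ 2 + 6 * k + 2) * (4 * (k + 1) ^ 2) ≤ (2 * (k + 1)) ^ 4 := by
    have : 4 * k ^ 2 + 6 * k + 2 ≤ 4 * (k + 1) ^ 2 := by nlinarith
    calc (4 * k ^ 2 + 6 * k + 2) * (4 * (k + 1) ^ 2) ≤ (4 * (k + 1) ^ 2) * (4 * (k + 1) ^ 2) :=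
        Nat.mul_le_mul_right _ this
      _ = (2 * (k + 1)) ^ 4 := by ring
  have hdev : (2 * (k + 1)) ^ 3 ≤ 2 * ((k + 2) * (4 * k ^ 2 + 6 * k + 2)) := by nlinarith
  have h1 : ((((4 * k ^ 2 + 6 * k + 2) * (4 * (k + 1) ^ 2) : ℕ)) : ℝ) ^ ((3 : ℝ) / 4) ≤
      (((2 * (k + 1)) ^ 4 : ℕ) : ℝ) ^ ((3 : ℝ) / 4) :=
    Real.rpow_le_rpow (by positivity) (by exact_mod_cast hn) (by norm_num)
  have h2 : (((2 * (k + 1)) ^ 4 : ℕ) : ℝ) ^ ((3 : ℝ) / 4) = (((2 * (k + 1)) ^ 3 : ℕ) : ℝ) := by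
    push_cast
    rw [← Real.rpow_natCast _ 4, ← Real.rpow_mul (by positivity), ← Real.rpow_natCast _ 3]
    norm_num
  have h3 : (((2 * (k + 1)) ^ 3 : ℕ) : ℝ) ≤ 2 * (((k + 2) * (4 * k ^ 2 + 6 * k + 2) : ℕ) : ℝ) := by
    exact_mod_cast hdev
  linarith

/-- There are arbitrarily large slabs. [cite: MaininiSchmidt2020, Theorem 1.1 (ii) (d = 2)] -/
theorem lt_card_planarSlab (k : ℕ) : k < #(planarSlab k) := by
  rw [card_planarSlab]
  nlinarith

/-- **Mainini–Schmidt 2020, Theorem 1.1 (ii) AT `d = 2` — a theorem** (the `d = 2` instance of the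
vendored fact `MaininiSchmidt2020_thm11_lower` of `EdgeIsoperimetricFluctuations.lean`, with
`K₂ = ½`): for every `ε > 0` there are infinitely many `n` (all the `#M_k`) admitting an `EIP²`
minimizer `C` (the slab `M_k = {1,…,4t²−2t} × {1,…,4t²}`) with `#((C − a) △ W_n) ≥ (½ − ε)·n^{3/4}`
for every `a ∈ ℤ²`, `W_n = {1,…,⌊√n⌋}²`, `3/4 = (d−1+2^{1−d})/d` at `d = 2`
(`maximalFluctuationExponent_two`) — the sharpness of the planar `n^{3/4}` law, "This follows
directly from Lemma 3.5". [cite: MaininiSchmidt2020, Theorem 1.1 (ii) and Lemma 3.5 (d = 2)] -/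
theorem MaininiSchmidt2020_thm11_lower_two :
    ∃ K : ℝ, 0 < K ∧ ∀ ε : ℝ, 0 < ε →
      {n : ℕ | ∃ C : Finset (Site 2), IsEIPMinimizer C ∧ #C = n ∧
        ∀ a : Site 2,
          (K - ε) * (n : ℝ) ^ maximalFluctuationExponent 2 ≤
            (#((C.image fun x => x - a) ∆ wulffCube 2 n) : ℝ)}.Infinite := by
  classical
  refine ⟨1 / 2, by norm_num, fun ε hε => ?_⟩
  refine Set.infinite_of_forall_exists_gt fun k => ⟨#(planarSlab k), ?_, lt_card_planarSlab k⟩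
  refine ⟨planarSlab k, isEIPMinimizer_planarSlab k, rfl, fun a => ?_⟩
  rw [maximalFluctuationExponent_two]
  -- `#((C − a) △ W) = #(C △ (W + a)) ≥ #(C ∖ (W + a))`
  have hsub : Function.Injective fun x : Site 2 => x - a := sub_left_injective
  have hW : (((wulffCube 2 #(planarSlab k)).image fun w => w + a).image fun x => x - a) =
      wulffCube 2 #(planarSlab k) := by
    rw [image_image]
    have : ((fun x : Site 2 => x - a) ∘ fun w => w + a) = id := by funext w; simp
    rw [this, image_id]
  have hcard : #((planarSlab k).image (fun x => x - a) ∆ wulffCube 2 #(planarSlab k)) =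
      #(planarSlab k ∆ (wulffCube 2 #(planarSlab k)).image fun w => w + a) := by
    conv_lhs => rw [← hW, ← image_symmDiff _ _ hsub]
    exact card_image_of_injective _ hsub
  have hQ : ∀ x ∈ (wulffCube 2 #(planarSlab k)).image (fun w => w + a),
      a 1 + 1 ≤ x 1 ∧ x 1 < a 1 + 1 + (4 * (k : ℤ) ^ 2 + 7 * k + 2) := by
    intro x hx
    obtain ⟨w, hw, rfl⟩ := mem_image.1 hx
    rw [wulffCube, Fintype.mem_piFinset, latticeRootFloor_card_planarSlab] at hw
    have hw1 := hw 1
    rw [mem_Icc] at hw1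
    simp only [Pi.add_apply]
    push_cast at hw1
    constructor <;> omega
  have hcount := le_card_planarSlab_sdiff_of k _ _ hQ
  have h5 : (#(planarSlab k \ (wulffCube 2 #(planarSlab k)).image fun w => w + a) : ℝ) ≤
      (#(planarSlab k ∆ (wulffCube 2 #(planarSlab k)).image fun w => w + a) : ℝ) := by
    exact_mod_cast card_le_card (by rw [Finset.symmDiff_def]; exact subset_union_left)
  have h6 := half_mul_rpow_card_planarSlab_le k
  have h7 : ((((k + 2) * (4 * k ^ 2 + 6 * k + 2)) : ℕ) : ℝ)
      ≤ (#(planarSlab k \ (wulffCube 2 #(planarSlab k)).image fun w => w + a) : ℝ) := by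
    exact_mod_cast hcount
  have h8 : 0 ≤ ε * (#(planarSlab k) : ℝ) ^ ((3 : ℝ) / 4) := by positivity
  rw [hcard]
  nlinarith

/-! ### [MS20] Theorem 1.1 (i) in the plane: every minimizer is `16·n^{3/4}`-close to a Wulff square -/

/-- **Strict superadditivity of the planar optimum**: `⌈2√(p+q)⌉ + 1 ≤ ⌈2√p⌉ + ⌈2√q⌉` for
`p, q ≥ 1` — two far-apart clusters always have more perimeter than one (the computation behind
"ground states are connected"). [cite: MaininiPiovanoStefanelli2014, Theorem 5.1 (C_n connected)] -/
theorem ceil_two_sqrt_add_one_le {p q : ℕ} (hp : 1 ≤ p) (hq : 1 ≤ q) :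
    ⌈2 * Real.sqrt ((p + q : ℕ) : ℝ)⌉₊ + 1 ≤ ⌈2 * Real.sqrt (p : ℝ)⌉₊ + ⌈2 * Real.sqrt (q : ℝ)⌉₊ := by
  have h1 : Real.sqrt 1 = 1 := Real.sqrt_one
  have hu : 1 ≤ Real.sqrt (p : ℝ) := by
    rw [← h1]; exact Real.sqrt_le_sqrt (by exact_mod_cast hp)
  have hv : 1 ≤ Real.sqrt (q : ℝ) := by
    rw [← h1]; exact Real.sqrt_le_sqrt (by exact_mod_cast hq)
  have hw : Real.sqrt ((p + q : ℕ) : ℝ) ^ 2 = Real.sqrt (p : ℝ) ^ 2 + Real.sqrt (q : ℝ) ^ 2 := by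
    rw [Real.sq_sqrt (by positivity), Real.sq_sqrt (by positivity), Real.sq_sqrt (by positivity)]
    push_cast
    ring
  have hX : 0 ≤ 2 * Real.sqrt (p : ℝ) + 2 * Real.sqrt (q : ℝ) - 1 := by linarith
  have hsq : (2 * Real.sqrt ((p + q : ℕ) : ℝ)) ^ 2 ≤
      (2 * Real.sqrt (p : ℝ) + 2 * Real.sqrt (q : ℝ) - 1) ^ 2 := by
    nlinarith [hw, mul_nonneg (sub_nonneg.2 hu) (sub_nonneg.2 hv)]
  have key : 2 * Real.sqrt ((p + q : ℕ) : ℝ) ≤ 2 * Real.sqrt (p : ℝ) + 2 * Real.sqrt (q : ℝ) - 1 := by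
    have := Real.sqrt_le_sqrt hsq
    rwa [Real.sqrt_sq (by positivity), Real.sqrt_sq hX] at this
  have hA := Nat.le_ceil (2 * Real.sqrt (p : ℝ))
  have hB := Nat.le_ceil (2 * Real.sqrt (q : ℝ))
  have hA2 : 2 ≤ ⌈2 * Real.sqrt (p : ℝ)⌉₊ := by
    have : (2 : ℝ) ≤ ⌈2 * Real.sqrt (p : ℝ)⌉₊ := by linarith
    exact_mod_cast this
  have hle : ⌈2 * Real.sqrt ((p + q : ℕ) : ℝ)⌉₊ ≤
      ⌈2 * Real.sqrt (p : ℝ)⌉₊ + ⌈2 * Real.sqrt (q : ℝ)⌉₊ - 1 := by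
    refine Nat.ceil_le.2 ?_
    have hcast : ((⌈2 * Real.sqrt (p : ℝ)⌉₊ + ⌈2 * Real.sqrt (q : ℝ)⌉₊ - 1 : ℕ) : ℝ) =
        (⌈2 * Real.sqrt (p : ℝ)⌉₊ : ℝ) + ⌈2 * Real.sqrt (q : ℝ)⌉₊ - 1 := by
      rw [Nat.cast_sub (by omega), Nat.cast_add, Nat.cast_one]
    rw [hcast]
    linarith
  omega

/-- In `ℤ²`, two points lie on one lattice line of direction `eᵢ` iff their other coordinates agree.
[folklore] -/
private theorem removeNth_eq_iff_apply_rev {i : Fin 2} {x y : Site 2} :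
    Fin.removeNth i x = Fin.removeNth i y ↔ x i.rev = y i.rev := by
  fin_cases i
  · exact removeNth_zero_eq_iff
  · exact removeNth_one_eq_iff

/-- `i.rev ≠ i` in `Fin 2`. [folklore] -/
private theorem rev_ne_self (i : Fin 2) : i.rev ≠ i := by
  fin_cases i <;> decide

/-- `#A ≤ (#columns)·(#rows)` with the columns read off coordinate `i` and the rows off `i.rev`.
[cite: FriedrichKreutz2023, §4.1 (n ≤ l(s₀)·lᵛ)] -/
theorem card_le_card_image_mul_card_image_rev (A : Finset (Site 2)) (i : Fin 2) :
    #A ≤ #(A.image fun z => z i) * #(A.image fun z => z i.rev) := by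
  have h := card_le_card_dropCoord_mul_two A
  rw [card_dropCoord_zero_eq, card_dropCoord_one_eq] at h
  fin_cases i
  · show #A ≤ #(A.image fun z => z 0) * #(A.image fun z => z 1)
    rwa [mul_comm] at h
  · show #A ≤ #(A.image fun z => z 1) * #(A.image fun z => z 0)
    exact h

/-- For an `EIP²` minimizer, `#columns + #rows = ⌈2√#C⌉` (line-convexity makes every occupied line
carry exactly two boundary pairs). [cite: MaininiPiovanoStefanelli2014, Proposition 6.3 with Theorem 5.1; FriedrichKreutz2023, §4.1 (F_bond = 2#𝒮)] -/
theorem IsEIPMinimizer.card_image_add_card_image_rev {C : Finset (Site 2)} (hC : IsEIPMinimizer C)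
    (i : Fin 2) :
    #(C.image fun z => z i) + #(C.image fun z => z i.rev) = ⌈2 * Real.sqrt (#C : ℝ)⌉₊ := by
  have h1 := card_boundaryPairs_eq_two_mul_sum_card_dropCoord_of_isLineConvex C hC.isLineConvex
  rw [(isEIPMinimizer_iff_card_boundaryPairs_eq C).1 hC, Fin.sum_univ_two, card_dropCoord_zero_eq,
    card_dropCoord_one_eq] at h1
  fin_cases i
  · show #(C.image fun z => z 0) + #(C.image fun z => z 1) = _
    omega
  · show #(C.image fun z => z 1) + #(C.image fun z => z 0) = _
    omega

/-- **An `EIP²` minimizer meets every lattice line inside its shadow** (the connectedness of ground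
states, [MPS14] Theorem 5.1, in the form needed here): if it has points on both sides of the line
`{x_i = c}`, it has a point on it — otherwise the two sides have disjoint columns and, by
line-convexity, disjoint rows, and `⌈2√n₁⌉ + ⌈2√n₂⌉ > ⌈2√n⌉`.
[cite: MaininiPiovanoStefanelli2014, Theorem 5.1 (ground states are connected) with Proposition 6.3] -/
theorem IsEIPMinimizer.exists_apply_eq_of_lt_of_lt {C : Finset (Site 2)} (hC : IsEIPMinimizer C)
    (i : Fin 2) {c : ℤ} (hl : ∃ z ∈ C, z i < c) (hr : ∃ z ∈ C, c < z i) : ∃ z ∈ C, z i = c := by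
  classical
  by_contra hc
  push Not at hc
  set CL := C.filter fun z => z i < c with hCL
  set CR := C.filter fun z => c < z i with hCR
  have hunion : CL ∪ CR = C := by
    ext z
    simp only [hCL, hCR, mem_union, mem_filter]
    constructor
    · rintro (⟨hz, -⟩ | ⟨hz, -⟩) <;> exact hz
    · intro hz
      rcases lt_or_gt_of_ne (hc z hz) with h | h
      · exact Or.inl ⟨hz, h⟩
      · exact Or.inr ⟨hz, h⟩
  have hdisj : Disjoint CL CR := by
    rw [hCL, hCR, disjoint_filter]
    intro z _ h1 h2
    omega
  have hn : #C = #CL + #CR := by rw [← hunion, card_union_of_disjoint hdisj]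
  have hnL : 1 ≤ #CL := by
    obtain ⟨z, hz, hzc⟩ := hl
    exact card_pos.2 ⟨z, mem_filter.2 ⟨hz, hzc⟩⟩
  have hnR : 1 ≤ #CR := by
    obtain ⟨z, hz, hzc⟩ := hr
    exact card_pos.2 ⟨z, mem_filter.2 ⟨hz, hzc⟩⟩
  -- columns split
  have hK : #(C.image fun z => z i) = #(CL.image fun z => z i) + #(CR.image fun z => z i) := by
    rw [← card_union_of_disjoint, ← image_union, hunion]
    rw [disjoint_left]
    intro x hxL hxR
    obtain ⟨z, hz, rfl⟩ := mem_image.1 hxL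
    obtain ⟨w, hw, hzw⟩ := mem_image.1 hxR
    rw [hCL, mem_filter] at hz
    rw [hCR, mem_filter] at hw
    omega
  -- rows are disjoint by line-convexity in direction `i`
  have hR : #(CL.image fun z => z i.rev) + #(CR.image fun z => z i.rev) ≤
      #(C.image fun z => z i.rev) := by
    rw [← card_union_of_disjoint]
    · exact card_le_card (union_subset (image_subset_image (filter_subset _ _))
        (image_subset_image (filter_subset _ _)))
    · rw [disjoint_left]
      intro y hyL hyR
      obtain ⟨u, hu, rfl⟩ := mem_image.1 hyL
      obtain ⟨w, hw, hwu⟩ := mem_image.1 hyR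
      rw [hCL, mem_filter] at hu
      rw [hCR, mem_filter] at hw
      let z : Site 2 := fun k => if k = i then c else u k
      have hzi : z i = c := by simp [z]
      have hzr : z i.rev = u i.rev := by simp [z, rev_ne_self i]
      have hz : z ∈ C :=
        hC.isLineConvex i u hu.1 w hw.1 (removeNth_eq_iff_apply_rev.2 hwu.symm) z
          (removeNth_eq_iff_apply_rev.2 hzr) (by rw [hzi]; exact hu.2.le) (by rw [hzi]; exact hw.2.le)
      exact hc z hz hzi
  have hbL := ceil_two_sqrt_le_add (card_le_card_image_mul_card_image_rev CL i)
  have hbR := ceil_two_sqrt_le_add (card_le_card_image_mul_card_image_rev CR i)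
  have hsum := hC.card_image_add_card_image_rev i
  have hstrict := ceil_two_sqrt_add_one_le hnL hnR
  rw [← hn] at hstrict
  omega

/-- **The columns (rows) of an `EIP²` minimizer form a lattice interval**: after a translation by
`x₁`, the `i`-th coordinates of its points fill exactly `{1, …, #columns}`.
[cite: MaininiPiovanoStefanelli2014, Theorem 5.1 (square, connected ground states) with Proposition 6.3] -/
theorem IsEIPMinimizer.exists_shift {C : Finset (Site 2)} (hC : IsEIPMinimizer C) (hne : C.Nonempty)
    (i : Fin 2) : ∃ x₁ : ℤ, ∀ z ∈ C, 1 ≤ z i - x₁ ∧ z i - x₁ ≤ #(C.image fun z => z i) := by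
  classical
  set K := C.image fun z => z i with hK
  have hKne : K.Nonempty := hne.image _
  have hsub : Icc (K.min' hKne) (K.max' hKne) ⊆ K := by
    intro x hx
    rw [mem_Icc] at hx
    rcases hx.1.eq_or_lt with h | h
    · rw [← h]; exact min'_mem _ _
    rcases hx.2.eq_or_lt with h' | h'
    · rw [h']; exact max'_mem _ _
    obtain ⟨zm, hzm, hzmi⟩ := mem_image.1 (min'_mem K hKne)
    obtain ⟨zM, hzM, hzMi⟩ := mem_image.1 (max'_mem K hKne)
    obtain ⟨z, hz, hzi⟩ := hC.exists_apply_eq_of_lt_of_lt i ⟨zm, hzm, by rw [hzmi]; exact h⟩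
      ⟨zM, hzM, by rw [hzMi]; exact h'⟩
    exact mem_image.2 ⟨z, hz, hzi⟩
  have hsup : K ⊆ Icc (K.min' hKne) (K.max' hKne) :=
    fun x hx => mem_Icc.2 ⟨min'_le _ _ hx, le_max' _ _ hx⟩
  have hcard : #K = #(Icc (K.min' hKne) (K.max' hKne)) := congrArg card (Subset.antisymm hsup hsub)
  rw [Int.card_Icc] at hcard
  have hmm : K.min' hKne ≤ K.max' hKne := min'_le _ _ (max'_mem _ _)
  refine ⟨K.min' hKne - 1, fun z hz => ?_⟩
  have hzK : z i ∈ K := mem_image_of_mem _ hz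
  have h1 := min'_le _ _ hzK
  have h2 := le_max' _ _ hzK
  constructor
  · omega
  · rw [hcard]; omega

/-- `|S ∆ T| + 2|S ∩ T| = |S| + |T|`. [folklore] -/
private theorem card_symmDiff_add_two_mul (S T : Finset (Site 2)) :
    #(S ∆ T) + 2 * #(S ∩ T) = #S + #T := by
  rw [symmDiff_def, show S \ T ⊔ T \ S = S \ T ∪ T \ S from rfl,
    card_union_of_disjoint disjoint_sdiff_sdiff]
  have h1 := card_sdiff_add_card_inter S T
  have h2 := card_sdiff_add_card_inter T S
  rw [inter_comm T S] at h2
  omega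

/-- The box arithmetic of the planar `n^{3/4}` law: for `a + b = g ∈ [2s, 2s+2]`, `s² ≤ n ≤ ab`,
a quantity `X` with `X + 2·min(a,s)·min(b,s) + n ≤ 2ab + s²` satisfies
`X ≤ 2s·|a − b| + 4s + 2`. [cite: MaininiSchmidt2020, Theorem 1.1 (i) (d = 2)] -/
private theorem box_symmDiff_arith {a b s n g X : ℕ} (hg : a + b = g) (h1 : 2 * s ≤ g)
    (h2 : g ≤ 2 * s + 2) (hs : s ^ 2 ≤ n) (hn : n ≤ a * b)
    (hX : X + 2 * (min a s * min b s) + n ≤ 2 * (a * b) + s ^ 2) :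
    X ≤ 2 * s * (max a b - min a b) + 4 * s + 2 := by
  rcases le_total s a with hsa | has <;> rcases le_total s b with hsb | hbs
  · -- `s ≤ a`, `s ≤ b`: then `a, b ≤ s + 2`
    rw [min_eq_right hsa, min_eq_right hsb] at hX
    obtain ⟨α, rfl⟩ := Nat.exists_eq_add_of_le hsa
    obtain ⟨β, rfl⟩ := Nat.exists_eq_add_of_le hsb
    have hα2 : α ≤ 2 := by omega
    have hβ2 : β ≤ 2 := by omega
    rcases le_total α β with hab | hba
    · rw [max_eq_right (by omega : s + α ≤ s + β), min_eq_left (by omega : s + α ≤ s + β)]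
      interval_cases α <;> interval_cases β <;> nlinarith
    · rw [max_eq_left (by omega : s + β ≤ s + α), min_eq_right (by omega : s + β ≤ s + α)]
      interval_cases α <;> interval_cases β <;> nlinarith
  · -- `b ≤ s ≤ a`
    rw [min_eq_right hsa, min_eq_left hbs, max_eq_left (le_trans hbs hsa),
      min_eq_right (le_trans hbs hsa)] at *
    obtain ⟨α, rfl⟩ := Nat.exists_eq_add_of_le hsa
    obtain ⟨β, rfl⟩ := Nat.exists_eq_add_of_le hbs
    have e1 : b + β + α - b = β + α := by omega
    rw [e1]
    nlinarith
  · -- `a ≤ s ≤ b`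
    rw [min_eq_left has, min_eq_right hsb, max_eq_right (le_trans has hsb),
      min_eq_left (le_trans has hsb)] at *
    obtain ⟨α, rfl⟩ := Nat.exists_eq_add_of_le hsb
    obtain ⟨β, rfl⟩ := Nat.exists_eq_add_of_le has
    have e1 : a + β + α - a = β + α := by omega
    rw [e1]
    nlinarith
  · -- `a, b ≤ s`: forces `a = b = s`
    have ha : a = s := by omega
    have hb : b = s := by omega
    subst ha; subst hb
    rw [min_self] at hX
    simp only [max_self, min_self, Nat.sub_self, mul_zero, zero_add]
    nlinarith

/-- The real-analysis step: `2s·d + 4s + 2 ≤ 16·n^{3/4}` when `d² ≤ 8s + 4`, `1 ≤ s`, `s² ≤ n`.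
[cite: MaininiSchmidt2020, Theorem 1.1 (i) (d = 2)] -/
private theorem fluctuation_real_bound {s d n : ℕ} (hs1 : 1 ≤ s) (hd : d ^ 2 ≤ 8 * s + 4)
    (hsn : s ^ 2 ≤ n) :
    ((2 * s * d + 4 * s + 2 : ℕ) : ℝ) ≤ 16 * (n : ℝ) ^ ((3 : ℝ) / 4) := by
  have hs0 : (0 : ℝ) < s := by exact_mod_cast hs1
  set r := Real.sqrt (s : ℝ) with hr
  have hr1 : 1 ≤ r := by
    rw [hr, ← Real.sqrt_one]; exact Real.sqrt_le_sqrt (by exact_mod_cast hs1)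
  have hr2 : r ^ 2 = s := Real.sq_sqrt hs0.le
  -- `s·√s ≤ n^{3/4}`
  have hm : (s : ℝ) * r ≤ (n : ℝ) ^ ((3 : ℝ) / 4) := by
    have h1 : (((s ^ 2 : ℕ) : ℝ)) ^ ((3 : ℝ) / 4) ≤ (n : ℝ) ^ ((3 : ℝ) / 4) :=
      Real.rpow_le_rpow (by positivity) (by exact_mod_cast hsn) (by norm_num)
    have h2 : (((s ^ 2 : ℕ) : ℝ)) ^ ((3 : ℝ) / 4) = (s : ℝ) * r := by
      push_cast
      rw [← Real.rpow_natCast _ 2, ← Real.rpow_mul hs0.le,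
        show ((2 : ℕ) : ℝ) * ((3 : ℝ) / 4) = 1 + 1 / 2 by norm_num, Real.rpow_add hs0, Real.rpow_one,
        hr, Real.sqrt_eq_rpow]
    rw [h2] at h1
    exact h1
  -- `s·d ≤ (7/2)·s·√s` from `d² ≤ 12 s`
  have hd' : ((d : ℕ) : ℝ) ^ 2 ≤ 12 * r ^ 2 := by
    rw [hr2]
    have : ((d ^ 2 : ℕ) : ℝ) ≤ ((8 * s + 4 : ℕ) : ℝ) := by exact_mod_cast hd
    push_cast at this
    have hs1' : (1 : ℝ) ≤ s := by exact_mod_cast hs1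
    nlinarith
  have hd2 : (d : ℝ) ≤ 7 / 2 * r := by
    have h0 : (0 : ℝ) ≤ 7 / 2 * r := by positivity
    have hsq : (d : ℝ) ^ 2 ≤ (7 / 2 * r) ^ 2 := by nlinarith
    have := Real.sqrt_le_sqrt hsq
    rwa [Real.sqrt_sq (by positivity), Real.sqrt_sq h0] at this
  have hs1' : (1 : ℝ) ≤ s := by exact_mod_cast hs1
  push_cast
  nlinarith [mul_le_mul_of_nonneg_left hd2 hs0.le, mul_le_mul_of_nonneg_left hr1 hs0.le]

/-- **Mainini–Schmidt 2020, Theorem 1.1 (i) AT `d = 2` — a theorem** (the `d = 2` instance of the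
vendored fact `MaininiSchmidt2020_thm11_upper`, with `K₂ = 16`; the planar `n^{3/4}` law of
Mainini–Piovano–Stefanelli): every `EIP²` minimizer `C` with `n` points has a translate `C − a`
with `#((C − a) △ W_n) ≤ 16·n^{3/4}`, `W_n = {1,…,⌊√n⌋}²`.  Proof: `C` is convex by rows and columns
and meets every line inside its shadow, so it lies in an `a × b` box with `a + b = ⌈2√n⌉`, whence
`ab − n ≤ 2s + 1` and `|a − b| ≤ √(8s+4)` (`s = ⌊√n⌋`); the box differs from the corner-aligned
Wulff square by `≤ 2s|a − b| + O(s)` points.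
[cite: MaininiSchmidt2020, Theorem 1.1 (i) (d = 2); MaininiPiovanoStefanelli2014, Theorem 8.1 and §8 (#(C_n △ G_n') ≤ 2n^{3/4} + O(n^{1/2})); FriedrichKreutz2023, Theorem 2.2] -/
theorem MaininiSchmidt2020_thm11_upper_two :
    ∃ K : ℝ, 0 < K ∧ ∀ (n : ℕ) (C : Finset (Site 2)), IsEIPMinimizer C → #C = n →
      ∃ a : Site 2,
        (#((C.image fun x => x - a) ∆ wulffCube 2 n) : ℝ) ≤ K * (n : ℝ) ^ maximalFluctuationExponent 2 := by
  classical
  refine ⟨16, by norm_num, fun n C hC hCn => ?_⟩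
  rw [maximalFluctuationExponent_two]
  obtain ⟨hs1, hs2⟩ : latticeRootFloor 2 n ^ 2 ≤ n ∧ n < (latticeRootFloor 2 n + 1) ^ 2 :=
    ⟨latticeRootFloor_pow_le (by norm_num) n, lt_latticeRootFloor_succ_pow (by norm_num) n⟩
  obtain ⟨s, hs⟩ : ∃ s, latticeRootFloor 2 n = s := ⟨_, rfl⟩
  rw [hs] at hs1 hs2
  rcases C.eq_empty_or_nonempty with rfl | hne
  · refine ⟨0, ?_⟩
    have hn : n = 0 := by rw [← hCn, card_empty]
    subst hn
    have hs0 : s = 0 := by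
      by_contra h
      have : 1 ≤ (s + 1) ^ 2 := Nat.one_le_pow _ _ (by omega)
      have : 1 ^ 2 ≤ s ^ 2 := Nat.pow_le_pow_left (by omega) 2
      omega
    have hW : wulffCube 2 0 = ∅ := by rw [← card_eq_zero, card_wulffCube, hs, hs0]; rfl
    rw [hW, image_empty]
    simp only [symmDiff_self, Finset.bot_eq_empty, card_empty, Nat.cast_zero]
    positivity
  -- the box
  obtain ⟨x₁, hx⟩ := hC.exists_shift hne 0
  obtain ⟨y₁, hy⟩ := hC.exists_shift hne 1
  set a := #(C.image fun z => z 0) with ha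
  set b := #(C.image fun z => z 1) with hb
  let v : Site 2 := ![x₁, y₁]
  refine ⟨v, ?_⟩
  set C' := C.image fun x => x - v with hC'
  set Bx : Finset (Site 2) := Fintype.piFinset ![Icc (1 : ℤ) a, Icc (1 : ℤ) b] with hBx
  set W := wulffCube 2 n with hWdef
  have hC'sub : C' ⊆ Bx := by
    intro z hz
    obtain ⟨x, hxC, rfl⟩ := mem_image.1 hz
    rw [hBx, Fintype.mem_piFinset, Fin.forall_fin_two]
    simp only [Matrix.cons_val_zero, Matrix.cons_val_one, mem_Icc, Pi.sub_apply, v]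
    exact ⟨hx x hxC, hy x hxC⟩
  have hC'card : #C' = n := by rw [hC', card_image_of_injective _ (sub_left_injective), hCn]
  have hBxcard : #Bx = a * b := by
    rw [hBx, Fintype.card_piFinset, Fin.prod_univ_two]
    simp only [Matrix.cons_val_zero, Matrix.cons_val_one, Int.card_Icc]
    have e1 : ((a : ℤ) + 1 - 1).toNat = a := by omega
    have e2 : ((b : ℤ) + 1 - 1).toNat = b := by omega
    rw [e1, e2]
  have hWcard : #W = s ^ 2 := by rw [hWdef, card_wulffCube, hs]
  have hBW : #(Bx ∩ W) = min a s * min b s := by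
    have heq : Bx ∩ W = Fintype.piFinset ![Icc (1 : ℤ) ((min a s : ℕ) : ℤ), Icc (1 : ℤ) ((min b s : ℕ) : ℤ)] := by
      ext z
      rw [mem_inter, hBx, hWdef, wulffCube, hs, Fintype.mem_piFinset, Fintype.mem_piFinset,
        Fintype.mem_piFinset, Fin.forall_fin_two, Fin.forall_fin_two, Fin.forall_fin_two]
      simp only [Matrix.cons_val_zero, Matrix.cons_val_one, mem_Icc, Nat.cast_min]
      omega
    rw [heq, Fintype.card_piFinset, Fin.prod_univ_two]
    simp only [Matrix.cons_val_zero, Matrix.cons_val_one, Int.card_Icc]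
    have e1 : (((min a s : ℕ) : ℤ) + 1 - 1).toNat = min a s := by omega
    have e2 : (((min b s : ℕ) : ℤ) + 1 - 1).toNat = min b s := by omega
    rw [e1, e2]
  -- counting the symmetric difference
  have hΔsub : C' ∆ W ⊆ (Bx \ C') ∪ (Bx ∆ W) := by
    intro z hz
    rw [mem_symmDiff] at hz
    rw [mem_union, Finset.mem_sdiff, mem_symmDiff]
    rcases hz with ⟨hzC, hzW⟩ | ⟨hzW, hzC⟩
    · exact Or.inr (Or.inl ⟨hC'sub hzC, hzW⟩)
    · by_cases hzB : z ∈ Bx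
      · exact Or.inl ⟨hzB, hzC⟩
      · exact Or.inr (Or.inr ⟨hzW, hzB⟩)
  have hΔ1 : #(C' ∆ W) ≤ #(Bx \ C') + #(Bx ∆ W) :=
    (card_le_card hΔsub).trans (card_union_le _ _)
  have hΔ2 := card_symmDiff_add_two_mul Bx W
  have hΔ3 := card_sdiff_add_card_eq_card hC'sub
  rw [hBxcard, hWcard, hBW] at hΔ2
  rw [hBxcard, hC'card] at hΔ3
  -- the arithmetic inputs
  have hsum : a + b = ⌈2 * Real.sqrt (n : ℝ)⌉₊ := by rw [← hCn]; exact hC.card_image_add_card_image_rev 0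
  have hnab : n ≤ a * b := by rw [← hCn]; exact card_le_card_image_mul_card_image_rev C 0
  have hsqrt1 : (s : ℝ) ≤ Real.sqrt n := by
    have := Real.sqrt_le_sqrt (show ((s : ℝ)) ^ 2 ≤ n by exact_mod_cast hs1)
    rwa [Real.sqrt_sq (by positivity)] at this
  have hsqrt2 : Real.sqrt n ≤ s + 1 := by
    have := Real.sqrt_le_sqrt (show (n : ℝ) ≤ ((s : ℝ) + 1) ^ 2 by exact_mod_cast hs2.le)
    rwa [Real.sqrt_sq (by positivity)] at this
  have hg1 : 2 * s ≤ ⌈2 * Real.sqrt (n : ℝ)⌉₊ := by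
    have := Nat.le_ceil (2 * Real.sqrt (n : ℝ))
    have h' : (2 * s : ℝ) ≤ ⌈2 * Real.sqrt (n : ℝ)⌉₊ := by linarith
    exact_mod_cast h'
  have hg2 : ⌈2 * Real.sqrt (n : ℝ)⌉₊ ≤ 2 * s + 2 := by
    refine Nat.ceil_le.2 ?_
    push_cast
    linarith
  have hX : #(C' ∆ W) + 2 * (min a s * min b s) + n ≤ 2 * (a * b) + s ^ 2 := by omega
  have hbox := box_symmDiff_arith hsum hg1 hg2 hs1 hnab hX
  -- `|a − b|² ≤ 8s + 4`
  have hd : (max a b - min a b) ^ 2 ≤ 8 * s + 4 := by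
    rcases le_total a b with hab | hba
    · rw [max_eq_right hab, min_eq_left hab]
      obtain ⟨d, hd⟩ := Nat.exists_eq_add_of_le hab
      rw [hd, Nat.add_sub_cancel_left]
      rw [hd] at hsum hnab
      nlinarith
    · rw [max_eq_left hba, min_eq_right hba]
      obtain ⟨d, hd⟩ := Nat.exists_eq_add_of_le hba
      rw [hd, Nat.add_sub_cancel_left]
      rw [hd] at hsum hnab
      nlinarith
  have hs_pos : 1 ≤ s := by
    by_contra h
    have h0 : s = 0 := by omega
    subst h0
    have : n = 0 := by omega
    rw [this] at hCn
    exact hne.ne_empty (card_eq_zero.1 hCn)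
  have hreal := fluctuation_real_bound hs_pos hd hs1
  calc (#(C' ∆ W) : ℝ) ≤ ((2 * s * (max a b - min a b) + 4 * s + 2 : ℕ) : ℝ) := by
        exact_mod_cast hbox
    _ ≤ 16 * (n : ℝ) ^ ((3 : ℝ) / 4) := hreal

end Fluctuation

/-! ### [MPSS19] Lemma 4.1: the planar configurations `𝓡_{s,p,q}` -/

section MPSSLemma

/-- The planar configurations `𝓡_{s,p,q} := R(s−p−1, s) ∪ L^p_{s−q}` of [MPSS19] §4, with
`L^p_{s−q} = ℤ² ∩ ({s−p} × [1, s−q])`: an `(s−p−1) × s` rectangle plus a partial column of `s − q`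
points on its right (`#𝓡_{s,p,q} = s² − sp − q`). [cite: MaininiPiovanoSchmidtStefanelli2019, §4 (𝓡_{s,p,q}, before Lemma 4.1)] -/
def mpssRect (s p q : ℕ) : Finset (Site 2) :=
  latticeRect (s - p - 1) s ∪ Fintype.piFinset ![Icc ((s : ℤ) - p) ((s : ℤ) - p), Icc (1 : ℤ) ((s : ℤ) - q)]

variable {s p q : ℕ}

/-- Membership in `𝓡_{s,p,q}` (for `p + 2 ≤ s`). [cite: MaininiPiovanoSchmidtStefanelli2019, §4 (𝓡_{s,p,q})] -/
theorem mem_mpssRect (hps : p + 2 ≤ s) {z : Site 2} :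
    z ∈ mpssRect s p q ↔ (1 ≤ z 0 ∧ z 0 ≤ (s : ℤ) - p - 1 ∧ 1 ≤ z 1 ∧ z 1 ≤ s) ∨
      (z 0 = (s : ℤ) - p ∧ 1 ≤ z 1 ∧ z 1 ≤ (s : ℤ) - q) := by
  rw [mpssRect, mem_union, mem_latticeRect, Fintype.mem_piFinset, Fin.forall_fin_two]
  simp only [Matrix.cons_val_zero, Matrix.cons_val_one, mem_Icc]
  have e : ((s - p - 1 : ℕ) : ℤ) = (s : ℤ) - p - 1 := by omega
  rw [e]
  constructor
  · rintro (h | h)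
    · exact Or.inl h
    · exact Or.inr ⟨le_antisymm h.1.2 h.1.1, h.2⟩
  · rintro (h | h)
    · exact Or.inl h
    · exact Or.inr ⟨⟨h.1.ge, h.1.le⟩, h.2⟩

/-- `#𝓡_{s,p,q} = s² − sp − q`. [cite: MaininiPiovanoSchmidtStefanelli2019, §4 (#𝓡_{s,p,q} = s² − sp − q)] -/
theorem card_mpssRect (hps : p + 2 ≤ s) (hq : q < s) : #(mpssRect s p q) = s ^ 2 - s * p - q := by
  rw [mpssRect, card_union_of_disjoint, card_latticeRect, Fintype.card_piFinset, Fin.prod_univ_two]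
  · simp only [Matrix.cons_val_zero, Matrix.cons_val_one, Int.card_Icc]
    have e1 : ((s : ℤ) - p + 1 - ((s : ℤ) - p)).toNat = 1 := by omega
    have e2 : ((s : ℤ) - q + 1 - 1).toNat = s - q := by omega
    rw [e1, e2]
    obtain ⟨t, rfl⟩ := Nat.exists_eq_add_of_le hps
    have e3 : (p + 2 + t) ^ 2 = (t + 1) * (p + 2 + t) + (p + 2 + t) * p + (p + 2 + t) := by ring
    have e4 : (p + 2 + t - p - 1) * (p + 2 + t) = (t + 1) * (p + 2 + t) := by
      rw [show p + 2 + t - p - 1 = t + 1 by omega]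
    rw [e4, show (p + 2 + t) ^ 2 - (p + 2 + t) * p - q = (t + 1) * (p + 2 + t) + (p + 2 + t) - q by
      omega]
    omega
  · rw [disjoint_left]
    intro z hz hz'
    rw [mem_latticeRect] at hz
    rw [Fintype.mem_piFinset, Fin.forall_fin_two] at hz'
    simp only [Matrix.cons_val_zero, mem_Icc] at hz'
    have e : ((s - p - 1 : ℕ) : ℤ) = (s : ℤ) - p - 1 := by omega
    omega

/-- `𝓡_{s,p,q}` is convex by rows and columns. [cite: MaininiPiovanoSchmidtStefanelli2019, Lemma 4.1 (proof: counting unit bonds of 𝓡_{s,p,q})] -/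
theorem isLineConvex_mpssRect (hps : p + 2 ≤ s) (i : Fin 2) : IsLineConvex i (mpssRect s p q) := by
  intro x hx y hy hxy z hzx hxz hzy
  rw [mem_mpssRect hps] at hx hy ⊢
  fin_cases i
  · have h1 : x 1 = y 1 := by simpa [Fin.removeNth] using congrFun hxy 0
    have h2 : z 1 = x 1 := by simpa [Fin.removeNth] using congrFun hzx 0
    have h3 : x 0 ≤ z 0 := by simpa using hxz
    have h4 : z 0 ≤ y 0 := by simpa using hzy
    omega
  · have h1 : x 0 = y 0 := by simpa [Fin.removeNth] using congrFun hxy 0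
    have h2 : z 0 = x 0 := by simpa [Fin.removeNth] using congrFun hzx 0
    have h3 : x 1 ≤ z 1 := by simpa using hxz
    have h4 : z 1 ≤ y 1 := by simpa using hzy
    omega

/-- The columns of `𝓡_{s,p,q}` are `{1, …, s − p}`. [cite: MaininiPiovanoSchmidtStefanelli2019, Lemma 4.1 (proof)] -/
theorem image_mpssRect_apply_zero (hps : p + 2 ≤ s) (hq : q < s) :
    (mpssRect s p q).image (fun z => z 0) = Icc (1 : ℤ) ((s : ℤ) - p) := by
  ext t
  simp only [mem_image, mem_Icc]
  constructor
  · rintro ⟨z, hz, rfl⟩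
    rw [mem_mpssRect hps] at hz
    omega
  · intro ht
    refine ⟨![t, 1], ?_, by simp⟩
    rw [mem_mpssRect hps]
    simp only [Matrix.cons_val_zero, Matrix.cons_val_one]
    omega

/-- The rows of `𝓡_{s,p,q}` are `{1, …, s}` (`p + 2 ≤ s`). [cite: MaininiPiovanoSchmidtStefanelli2019, Lemma 4.1 (proof)] -/
theorem image_mpssRect_apply_one (hps : p + 2 ≤ s) :
    (mpssRect s p q).image (fun z => z 1) = Icc (1 : ℤ) (s : ℤ) := by
  ext t
  simp only [mem_image, mem_Icc]
  constructor
  · rintro ⟨z, hz, rfl⟩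
    rw [mem_mpssRect hps] at hz
    omega
  · intro ht
    refine ⟨![1, t], ?_, by simp⟩
    rw [mem_mpssRect hps]
    simp only [Matrix.cons_val_zero, Matrix.cons_val_one]
    omega

/-- The edge perimeter of `𝓡_{s,p,q}` is `2((s − p) + s)` — twice columns plus rows (the printed
count of unit bonds `(s−1)(s−p−1) + s(s−p−2) + 2(s−q) − 1`, in boundary form).
[cite: MaininiPiovanoSchmidtStefanelli2019, Lemma 4.1 (proof: number of unit bonds of 𝓡_{s,p,q})] -/
theorem card_boundaryPairs_mpssRect (hps : p + 2 ≤ s) (hq : q < s) :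
    #(boundaryPairs (mpssRect s p q)) = 2 * ((s - p) + s) := by
  have hb : #(boundaryPairs (mpssRect s p q)) = 2 * ∑ i : Fin 2, #(dropCoord i (mpssRect s p q)) :=
    card_boundaryPairs_eq_two_mul_sum_card_dropCoord_of_isLineConvex _
      (isLineConvex_mpssRect (q := q) hps)
  simp only [Fin.sum_univ_two] at hb
  have h0 := card_dropCoord_zero_eq (mpssRect s p q)
  have h1 := card_dropCoord_one_eq (mpssRect s p q)
  have hr : #((mpssRect s p q).image fun z => z 1) = s := by
    rw [image_mpssRect_apply_one hps, Int.card_Icc]; omega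
  have hc : #((mpssRect s p q).image fun z => z 0) = s - p := by
    rw [image_mpssRect_apply_zero hps hq, Int.card_Icc]; omega
  omega

/-- `⌈2√n⌉ ≤ m` as soon as `4n ≤ m²`. [folklore] -/
private theorem natCeil_two_sqrt_le_of_sq {n m : ℕ} (h : 4 * n ≤ m ^ 2) :
    ⌈2 * Real.sqrt (n : ℝ)⌉₊ ≤ m := by
  refine Nat.ceil_le.2 ?_
  have h4 : Real.sqrt 4 = 2 := by
    rw [show (4 : ℝ) = 2 ^ 2 by norm_num, Real.sqrt_sq (by norm_num : (0 : ℝ) ≤ 2)]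
  calc 2 * Real.sqrt (n : ℝ) = Real.sqrt (4 * n) := by
        rw [Real.sqrt_mul (by norm_num : (0 : ℝ) ≤ 4), h4]
    _ ≤ Real.sqrt ((m : ℝ) ^ 2) := Real.sqrt_le_sqrt (by exact_mod_cast h)
    _ = m := Real.sqrt_sq (Nat.cast_nonneg m)

/-- **[MPSS19] Lemma 4.1, PROVED** (for `p ≤ s − 2`): `𝓡_{s,p,q}` (`q < s`) is an `EIP²` minimizer
if and only if `4(s − q) > (p + 1)²` — its perimeter is `2(2s − p)` while
`⌈2√(s² − sp − q)⌉ = 2s − p` exactly when `(2s − p − 1)² < 4(s² − sp − q)`.  (Printed for all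
`p < s`; for `p = s − 1` the rectangle `R(0, s)` is empty, `𝓡 = L^p_{s−q}` is a bare column and the
equivalence fails — e.g. `s = 2, p = q = 1`: a single point is a minimizer although
`4(s−q) = 4 = (p+1)²` — so the hypothesis here is `p + 2 ≤ s`, which covers every use in §4.)
[cite: MaininiPiovanoSchmidtStefanelli2019, Lemma 4.1] -/
theorem MaininiPiovanoSchmidtStefanelli2019_lemma41 (hps : p + 2 ≤ s) (hq : q < s) :
    IsEIPMinimizer (mpssRect s p q) ↔ (p + 1) ^ 2 < 4 * (s - q) := by
  rw [isEIPMinimizer_iff_card_boundaryPairs_eq, card_boundaryPairs_mpssRect hps hq,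
    card_mpssRect hps hq]
  obtain ⟨t, rfl⟩ := Nat.exists_eq_add_of_le hps
  -- `s = p + 2 + t`; `n = s² − sp − q`, perimeter `2(2s − p)`
  have hn : (p + 2 + t) ^ 2 - (p + 2 + t) * p - q = (t + 2) * (p + 2 + t) - q := by
    have : (p + 2 + t) ^ 2 = (t + 2) * (p + 2 + t) + (p + 2 + t) * p := by ring
    omega
  rw [hn]
  have e1 : p + 2 + t - p + (p + 2 + t) = (p + 2 * t + 3) + 1 := by omega
  rw [e1]
  have hid : 4 * ((t + 2) * (p + 2 + t) - q) + (p + 1) ^ 2 = (p + 2 * t + 3) ^ 2 + 4 * (p + 2 + t - q) := by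
    have hq' : q ≤ (t + 2) * (p + 2 + t) := by nlinarith
    have hq'' : q ≤ p + 2 + t := by omega
    zify [hq', hq'']
    ring
  constructor
  · intro h
    by_contra hlt
    have hle : 4 * ((t + 2) * (p + 2 + t) - q) ≤ (p + 2 * t + 3) ^ 2 := by omega
    have := natCeil_two_sqrt_le_of_sq hle
    omega
  · intro h
    have h1a : 4 * ((t + 2) * (p + 2 + t) - q) ≤ 4 * ((t + 2) * (p + 2 + t)) :=
      Nat.mul_le_mul_left _ (Nat.sub_le _ _)
    have h1b : (p + 2 * t + 3 + 1) ^ 2 = 4 * ((t + 2) * (p + 2 + t)) + p ^ 2 := by ring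
    have h1 : 4 * ((t + 2) * (p + 2 + t) - q) ≤ (p + 2 * t + 3 + 1) ^ 2 := by omega
    have h2 : (p + 2 * t + 3) ^ 2 < 4 * ((t + 2) * (p + 2 + t) - q) := by omega
    rw [natCeil_two_sqrt_eq h1 h2]

/-- **[MPSS19] Lemma 4.1, "in particular"**: with `p = ⌊√s⌋` and `q = ⌊s/4⌋` the configuration
`𝓡_{s,p,q}` is an `EIP²` minimizer (printed for `s ≥ 2`; here `s ≥ 3`, where `⌊√s⌋ ≤ s − 2`).
[cite: MaininiPiovanoSchmidtStefanelli2019, Lemma 4.1 (in particular)] -/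
theorem isEIPMinimizer_mpssRect_sqrt (hs : 3 ≤ s) : IsEIPMinimizer (mpssRect s (Nat.sqrt s) (s / 4)) := by
  have hr := Nat.sqrt_le s
  have hr2 : Nat.sqrt s + 2 ≤ s := by
    by_contra h
    have h3 : s - 1 ≤ Nat.sqrt s := by omega
    have : (s - 1) * (s - 1) ≤ Nat.sqrt s * Nat.sqrt s := Nat.mul_le_mul h3 h3
    have h4 : (s - 1) * (s - 1) ≤ s := le_trans this hr
    obtain ⟨v, hv⟩ : ∃ v, s = v + 3 := ⟨s - 3, by omega⟩
    subst hv
    have : (v + 3 - 1) * (v + 3 - 1) = v * v + 4 * v + 4 := by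
      rw [show v + 3 - 1 = v + 2 by omega]; ring
    omega
  have hq : s / 4 < s := by omega
  rw [MaininiPiovanoSchmidtStefanelli2019_lemma41 hr2 hq]
  have e : (Nat.sqrt s + 1) ^ 2 = Nat.sqrt s * Nat.sqrt s + 2 * Nat.sqrt s + 1 := by ring
  have hdiv : 4 * (s / 4) ≤ s := Nat.mul_div_le s 4
  omega

end MPSSLemma

end Literature.MathematicalPhysics.StatisticalMechanics

end
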